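import Literature.Analysis.OperatorTheory.Enflo2023.MCStep
import Literature.Analysis.OperatorTheory.Enflo2023.Resolvent
import Literature.Analysis.OperatorTheory.Enflo2023.FirstOrder
import HarnessLib

/-!
# Enflo (2023), v2 pp.16–19: (34)–(38) ⟹ the constrained Main-Construction step, WITH REMAINDERS

P. H. Enflo, *On the invariant subspace problem in Hilbert spaces*, arXiv:2305.15442v2 (2023) — a CLAIMED result
under adjudication; nothing in this file asserts the manuscript's theorem.  This module formalises, kernel-tight,
the inference the referee reports flag as "first order only, no remainder terms" (pp.16–19, (34)–(46); reports
S16/S18): GIVEN the text's independence hypothesis (34)–(38) in an honest quantitative form, the Main-Construction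
step with the side condition (46), the exact decrement (b′) and the drift (45) EXISTS, remainders included.

## The dictionary (v2 ↔ this file)
* `W : E →L[ℂ] H` — the NORMALISED coefficient operator `C^{1/2}V_{y'}` (p.5–6; `StateLevel.Wn`), so that the MC
  vector is the bracket point `z = [ ]⁻¹x₀`, `[ ] = I + WW†` ((13)–(15); `brOp`, `brInv`, `bz`), and
  `(εθ) = Re⟪z, x₀ − z⟫ = ‖W†z‖²` ((16); `eth`, `eth_bz`);
* a step `y' ↦ y' + r(T)y'` (p.16) is `W ↦ W(1 + N)` with `N` in the commutant of the coefficient contraction `S`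
  (`Comm`, so `V ∘ S = T ∘ V` persists); then `[ ]' = [ ] + W·Q(N)·W†`, `Q(N) = N + N† + NN†` (`brOp_perturb`), and
  the new MC vector is `z_N = [ ]'⁻¹x₀` (`zN`);
* the three first-order functionals of (35)–(37) — drift `Re⟪x₀, δz⟫`, side condition `⟪c, δz⟫` (complex) and
  decrement `δ(εθ)` — have the EXACT two-point expansions `drift_two_point`, `side_two_point`, `eth_two_point`, whose
  linear parts in `Δ = N₂ − N₁` are `−Re⟪a, (Δ+Δ†)a⟫`, `−⟪W†[ ]⁻¹c, (Δ+Δ†)a⟫`, `−Re⟪W†[ ]⁻¹(x₀ − 2z), (Δ+Δ†)a⟫`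
  (`a = W†z`; `Λf`) and whose REMAINDERS are bounded by `36 r A²‖Δ‖`, `18 r ‖c‖A‖Δ‖`, `224 r A²‖Δ‖` on the ball
  `‖N‖ ≤ r ≤ 1/10` (`drift_remainder`, `side_remainder`, `eth_remainder`; `A = ‖a‖ = (εθ)^{1/2}`).

## What is HYPOTHESIS and what is THEOREM
* HYPOTHESIS, faithful form `IndepBr₂ W x₀ c ι σ` (§G; (34) made quantitative, p.16 "s(εθ)-independent for some
  s > 0"): the normalised first-order map of the TWO TARGETED functionals — side condition and decrement, scaled by
  `A‖c‖`, `A²` — `Λ₂ : P → ℂ × ℝ` has, for every target `t`, a preimage of norm `≤ ‖t‖/σ`, over a real Banach space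
  `P` of admissible directions (`ι : P → {S}'`); over the commutant of the shift this is literally the `(εθ)`-linear
  independence of `f f̄`, `f ḡ` of (28″)–(29″)/(34)–(36).  NOT proved here or anywhere.
  The THREE-fold form `IndepBr` (drift targeted too) is kept, with a WARNING: for the natural side vector
  `c = x₀ − z` the three functionals are linearly DEPENDENT (`first_order_dependent`: decrement = 2Re(side) − drift,
  normalised), so `IndepBr W x₀ (x₀ − z) ι σ` is FALSE for every `W`, `σ` (`not_indepBr_self`) — the drift (45) is a
  consequence of the step, not a free target (v2 p.19 "from (39) … we now conclude (45)").
* THEOREM `exists_step₂` / `exists_state_step₂` (§G): under `IndepBr₂ … σ` with `0 < σ ≤ 1`, for every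
  `0 ≤ β ≤ σ²/1000` there is an admissible `N = ι p`, `‖p‖ ≤ 2β/σ`, whose new MC vector has EXACTLY
  `(εθ)' = (1 − β)(εθ)` and `⟪c, z' − z⟫ = 0`, drift `|Re⟪x₀, z' − z⟫| ≤ (22/σ)β(εθ)` and radius change
  `|‖z'‖² − ‖z‖²| ≤ (22/σ + 1)β(εθ)` — a TRUE MC state (`exists_state_step₂` builds the `MCStep.State`, given the
  window margin).  (`exists_step` / `exists_state_step` are the three-fold versions: exact drift `−β(εθ)`, same
  radius.)  The engine is Graves' surjection theorem in Mathlib's form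
  `ApproximatesLinearOn.surjOn_closedBall_of_nonlinearRightInverse` with Lipschitz defect `250ρ` on the ball of
  radius `ρ ≤ σ/500` (`approximatesLinearOn`), which is where the size law `β ≤ σ²/1000` comes from.
* The run-level use (`ClaimRun` with the radius invariant, a non-trivial closed invariant subspace,
  `Referee.ISP_separable`) is in the companion module `StepRealisationRun`; the located gap (one `σ` along the whole
  run, for the two targeted functionals) is recorded in `pub-enflo/GAP.md` §"Formaliser 2, generation 11".

Sections: A. `[ ]⁻¹` and energy bounds · B. the perturbation identities · C. the three functionals, exact two-point
forms · D. remainder estimates · E. Graves (three-fold) · G. (inside E) dependence at the pivot and the faithful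
two-fold form · F. the commutant and the step at the level of `MCStep.State` (three-fold and two-fold).
-/

noncomputable section

open scoped InnerProductSpace ComplexConjugate NNReal
open ContinuousLinearMap RCLike Metric Set
open Literature.Analysis.UnboundedOperators (inner_self_eq_coe_norm_sq)

namespace Literature.Analysis.OperatorTheory.Enflo2023

namespace StepRealisation

variable {E H : Type*} [NormedAddCommGroup E] [InnerProductSpace ℂ E] [CompleteSpace E]
  [NormedAddCommGroup H] [InnerProductSpace ℂ H] [CompleteSpace H]

/-! ### A. `[ ] = I + WW†` (v2 (13)), its inverse and the energy bounds -/

/-- `[ ] := I + W W†` (v2 (13) with `W = V_y`). [cite: Enflo2023, v2 (13), p.6] -/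
def brOp (W : E →L[ℂ] H) : H →L[ℂ] H := 1 + W ∘L adjoint W

/-- `[ ]u = u + WW†u`. [cite: Enflo2023, v2 (13), p.6] -/
@[simp] lemma brOp_apply (W : E →L[ℂ] H) (u : H) : brOp W u = u + W (adjoint W u) := rfl

/-- `[ ] = I + WW†` is invertible (`WW† ≥ 0`). [cite: Enflo2023, v2 (13)–(15), p.6] -/
theorem isUnit_brOp (W : E →L[ℂ] H) : IsUnit (brOp W) :=
  isUnit_one_add_of_isPositive _ (ContinuousLinearMap.isPositive_self_comp_adjoint W)

/-- `[ ]⁻¹ = (I + WW†)⁻¹`. [cite: Enflo2023, v2 (15), p.6] -/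
def brInv (W : E →L[ℂ] H) : H →L[ℂ] H := ((isUnit_brOp W).unit⁻¹ : (H →L[ℂ] H)ˣ)

/-- `[ ][ ]⁻¹ = I`. [cite: Enflo2023, v2 (15), p.6] -/
theorem brOp_brInv (W : E →L[ℂ] H) (u : H) : brOp W (brInv W u) = u := by
  have h : brOp W * brInv W = 1 := (isUnit_brOp W).mul_val_inv
  simpa using congrArg (fun A : H →L[ℂ] H => A u) h

/-- `[ ]⁻¹[ ] = I`. [cite: Enflo2023, v2 (15), p.6] -/
theorem brInv_brOp (W : E →L[ℂ] H) (u : H) : brInv W (brOp W u) = u := by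
  have h : brInv W * brOp W = 1 := (isUnit_brOp W).val_inv_mul
  simpa using congrArg (fun A : H →L[ℂ] H => A u) h

/-- `[ ]⁻¹u` is the bracket point of `u` (`Resolvent.IsBracket`). [cite: Enflo2023, v2 (15), p.6] -/
theorem isBracket_brInv (W : E →L[ℂ] H) (u : H) : IsBracket W u (brInv W u) := by
  have h := brOp_brInv W u
  rwa [brOp_apply] at h

/-- … and every bracket point is `[ ]⁻¹x₀`. [cite: Enflo2023, v2 (15), p.6] -/
theorem brInv_eq_of_isBracket {W : E →L[ℂ] H} {x₀ z : H} (h : IsBracket W x₀ z) : brInv W x₀ = z :=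
  (isBracket_brInv W x₀).unique h

/-- Linearity packaged: `[ ]⁻¹h − u = [ ]⁻¹(h − [ ]u)`. [folklore] -/
theorem brInv_sub (W : E →L[ℂ] H) (h u : H) : brInv W h - u = brInv W (h - brOp W u) := by
  rw [map_sub, brInv_brOp]

/-- `[ ]⁻¹` is symmetric: `⟪h, [ ]⁻¹u⟫ = ⟪[ ]⁻¹h, u⟫`. [folklore] -/
theorem inner_brInv_comm (W : E →L[ℂ] H) (h u : H) : ⟪h, brInv W u⟫_ℂ = ⟪brInv W h, u⟫_ℂ := by
  have key : ∀ w w' : H, ⟪w' + W (adjoint W w'), w⟫_ℂ = ⟪w', w + W (adjoint W w)⟫_ℂ := by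
    intro w w'
    rw [inner_add_left, inner_add_right, ← adjoint_inner_right W (adjoint W w') w,
      ← adjoint_inner_left W (adjoint W w) w']
  have h2 := key (brInv W u) (brInv W h)
  rwa [← brOp_apply, ← brOp_apply, brOp_brInv, brOp_brInv] at h2

/-- The energy identity: for `w = [ ]⁻¹u`, `‖w‖² + ‖W†w‖² = Re⟪u, w⟫`. [folklore] -/
theorem energy (W : E →L[ℂ] H) (u : H) :
    ‖brInv W u‖ ^ 2 + ‖adjoint W (brInv W u)‖ ^ 2 = (⟪u, brInv W u⟫_ℂ).re := by
  have h := re_inner_one_add W (brInv W u)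
  rw [← brOp_apply, brOp_brInv] at h
  exact h.symm

/-- Scalar lemma behind the energy bounds. [folklore] -/
lemma arith_energy {w X U : ℝ} (hU : 0 ≤ U) (h : w ^ 2 + X ^ 2 ≤ U * w) :
    w ≤ U ∧ X ≤ U / 2 := by
  constructor
  · by_contra hc
    push Not at hc
    nlinarith [mul_pos (sub_pos.2 hc) (hU.trans_lt hc)]
  · have h2 : X ^ 2 ≤ (U / 2) ^ 2 := by nlinarith [sq_nonneg (w - U / 2)]
    by_contra hc
    push Not at hc
    nlinarith [mul_pos (sub_pos.2 hc) (show (0 : ℝ) < X + U / 2 by linarith)]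

/-- `‖[ ]⁻¹u‖ ≤ ‖u‖`. [folklore] -/
theorem norm_brInv_le (W : E →L[ℂ] H) (u : H) : ‖brInv W u‖ ≤ ‖u‖ := by
  have h := energy W u
  have h1 : (⟪u, brInv W u⟫_ℂ).re ≤ ‖u‖ * ‖brInv W u‖ :=
    (Complex.re_le_norm _).trans (norm_inner_le_norm _ _)
  exact (arith_energy (norm_nonneg u) (h.le.trans h1)).1

section weighted

/-! Energy bounds for `[ ]'⁻¹ := (I + W'W'†)⁻¹` measured through a second operator `W` with
`μ‖W†w‖ ≤ ‖W'†w‖` (below: `W' = W(1+N)`, `μ = 1 − ‖N‖`). -/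

variable {W W' : E →L[ℂ] H} {μ : ℝ}

/-- `‖W†[ ]'⁻¹u‖ ≤ ‖u‖/(2μ)`. [folklore] -/
theorem norm_adjoint_brInv_le (hμ0 : 0 < μ) (hμ : ∀ w : H, μ * ‖adjoint W w‖ ≤ ‖adjoint W' w‖) (u : H) :
    ‖adjoint W (brInv W' u)‖ ≤ ‖u‖ / (2 * μ) := by
  have h := energy W' u
  have h1 : (⟪u, brInv W' u⟫_ℂ).re ≤ ‖u‖ * ‖brInv W' u‖ :=
    (Complex.re_le_norm _).trans (norm_inner_le_norm _ _)
  have h2 := (arith_energy (norm_nonneg u) (h.le.trans h1)).2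
  have h3 := hμ (brInv W' u)
  rw [le_div_iff₀ (by positivity)]
  nlinarith

/-- `‖[ ]'⁻¹(W b)‖ ≤ ‖b‖/(2μ)` and `‖W†[ ]'⁻¹(W b)‖ ≤ ‖b‖/μ²`. [folklore] -/
theorem norm_brInv_map_le (hμ0 : 0 < μ) (hμ : ∀ w : H, μ * ‖adjoint W w‖ ≤ ‖adjoint W' w‖) (b : E) :
    ‖brInv W' (W b)‖ ≤ ‖b‖ / (2 * μ) ∧ ‖adjoint W (brInv W' (W b))‖ ≤ ‖b‖ / μ ^ 2 := by
  set w := brInv W' (W b) with hw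
  have h := energy W' (W b)
  have h1 : (⟪W b, w⟫_ℂ).re ≤ ‖b‖ * ‖adjoint W w‖ := by
    rw [← adjoint_inner_right W b w]
    exact (Complex.re_le_norm _).trans (norm_inner_le_norm _ _)
  have h3 := hμ w
  -- `‖w‖² + X'² ≤ ‖b‖‖W†w‖ ≤ (‖b‖/μ) X'`
  have h4 : ‖w‖ ^ 2 + ‖adjoint W' w‖ ^ 2 ≤ ‖b‖ / μ * ‖adjoint W' w‖ := by
    rw [← hw] at h
    rw [h, div_mul_eq_mul_div, le_div_iff₀ hμ0]
    nlinarith [norm_nonneg b]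
  -- swap the roles of `w` and `X'` in the scalar lemma
  have h5 := arith_energy (by positivity : 0 ≤ ‖b‖ / μ)
    (show ‖adjoint W' w‖ ^ 2 + ‖w‖ ^ 2 ≤ ‖b‖ / μ * ‖adjoint W' w‖ by linarith)
  refine ⟨?_, ?_⟩
  · rw [hw] at h5
    calc ‖brInv W' (W b)‖ ≤ ‖b‖ / μ / 2 := h5.2
      _ = ‖b‖ / (2 * μ) := by ring
  · rw [le_div_iff₀ (by positivity)]
    have h6 : ‖adjoint W' w‖ ≤ ‖b‖ / μ := h5.1
    have h7 : μ * ‖adjoint W w‖ ≤ ‖b‖ / μ := h3.trans h6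
    rw [le_div_iff₀ hμ0] at h7
    nlinarith

end weighted

/-- The comparison hypothesis for `W' = W(1+N)`: `‖(1+N)†x‖ ≥ (1 − ‖N‖)‖x‖`. [folklore] -/
theorem adjoint_perturb_lower (W : E →L[ℂ] H) {N : E →L[ℂ] E} {ν : ℝ} (hN : ‖N‖ ≤ ν) (w : H) :
    (1 - ν) * ‖adjoint W w‖ ≤ ‖adjoint (W ∘L (1 + N)) w‖ := by
  have hx : adjoint (W ∘L (1 + N)) w = adjoint W w + adjoint N (adjoint W w) := by
    simp [adjoint_comp]
  rw [hx]
  set x := adjoint W w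
  have h1 : ‖adjoint N x‖ ≤ ν * ‖x‖ := by
    calc ‖adjoint N x‖ ≤ ‖adjoint N‖ * ‖x‖ := le_opNorm _ _
      _ = ‖N‖ * ‖x‖ := by rw [LinearIsometryEquiv.norm_map]
      _ ≤ ν * ‖x‖ := by gcongr
  have h2 : ‖x‖ ≤ ‖x + adjoint N x‖ + ‖adjoint N x‖ := by
    have := norm_sub_le (x + adjoint N x) (adjoint N x)
    rwa [add_sub_cancel_right] at this
  nlinarith [norm_nonneg x]

/-- The base case `W' = W`, `μ = 1`. [folklore] -/
lemma adjoint_self_lower (W : E →L[ℂ] H) (w : H) : (1 : ℝ) * ‖adjoint W w‖ ≤ ‖adjoint W w‖ := by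
  rw [one_mul]

/-! ### B. The perturbation `W ↦ W(1+N)` (the text's `y → y + r(T)y`, v2 p.16) and the exact change of `[ ]⁻¹x₀` -/

/-- `Q(N) := N + N† + NN†`, so that `W(1+N)(W(1+N))† = WW† + W Q(N) W†`. [cite: Enflo2023, v2 p.14–15 (the change `[ ] → [ ] + B`)] -/
def Q (N : E →L[ℂ] E) : E →L[ℂ] E := N + adjoint N + N ∘L adjoint N

/-- `W(1+N)(W(1+N))†u = WW†u + W Q(N) W†u`. [cite: Enflo2023, v2 p.14–15] -/
theorem perturb_comp_adjoint (W : E →L[ℂ] H) (N : E →L[ℂ] E) (u : H) :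
    (W ∘L (1 + N)) (adjoint (W ∘L (1 + N)) u) = W (adjoint W u) + W (Q N (adjoint W u)) := by
  simp only [adjoint_comp, map_add, adjoint_one, comp_apply, add_apply, Q]
  simp
  abel

/-- `[ ]_N = [ ] + W Q(N) W†` applied to a vector. [cite: Enflo2023, v2 p.14–15] -/
theorem brOp_perturb (W : E →L[ℂ] H) (N : E →L[ℂ] E) (u : H) :
    brOp (W ∘L (1 + N)) u = brOp W u + W (Q N (adjoint W u)) := by
  rw [brOp_apply, brOp_apply, perturb_comp_adjoint, add_assoc]

omit [CompleteSpace E] [CompleteSpace H] in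
/-- `N = 0` changes nothing: `W(1+0) = W`. [folklore] -/
@[simp] lemma perturb_zero (W : E →L[ℂ] H) : W ∘L (1 + (0 : E →L[ℂ] E)) = W := by
  rw [add_zero, one_def, comp_id]

/-- THE EXACT CHANGE of `[ ]⁻¹x₀` (v2 p.14 "ch", first form): with `z = [ ]⁻¹x₀`, `ℓ = W†z`, `z_N = [ ]_N⁻¹x₀`,
`z_N − z = −[ ]_N⁻¹(W Q(N) ℓ)`.  Its first-order part in `N` is the text's `−[ ]⁻¹B[ ]⁻¹x₀`. [cite: Enflo2023, v2 p.14–15, (28)] -/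
theorem step_sub_eq (W : E →L[ℂ] H) (N : E →L[ℂ] E) (x₀ : H) :
    brInv (W ∘L (1 + N)) x₀ - brInv W x₀ =
      -brInv (W ∘L (1 + N)) (W (Q N (adjoint W (brInv W x₀)))) := by
  rw [brInv_sub, brOp_perturb, brOp_brInv, sub_add_cancel_left, map_neg]

/-- THE EXACT CHANGE, second form: `z_N − z = −[ ]⁻¹(W Q(N) W† z_N)`. [cite: Enflo2023, v2 p.14–15, (28)] -/
theorem step_sub_eq' (W : E →L[ℂ] H) (N : E →L[ℂ] E) (x₀ : H) :
    brInv (W ∘L (1 + N)) x₀ - brInv W x₀ =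
      -brInv W (W (Q N (adjoint W (brInv (W ∘L (1 + N)) x₀)))) := by
  have h := brInv_sub W x₀ (brInv (W ∘L (1 + N)) x₀)
  have h2 : brOp W (brInv (W ∘L (1 + N)) x₀) =
      x₀ - W (Q N (adjoint W (brInv (W ∘L (1 + N)) x₀))) := by
    rw [eq_sub_iff_add_eq, ← brOp_perturb, brOp_brInv]
  rw [h2, sub_sub_cancel] at h
  rw [← neg_sub, h]

/-- THE TWO-POINT FORM: `z_{N₂} − z_{N₁} = −[ ]_{N₂}⁻¹(W (Q(N₂) − Q(N₁)) W† z_{N₁})`. [cite: Enflo2023, v2 p.14–15, (28)] -/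
theorem two_point_sub_eq (W : E →L[ℂ] H) (N₁ N₂ : E →L[ℂ] E) (x₀ : H) :
    brInv (W ∘L (1 + N₂)) x₀ - brInv (W ∘L (1 + N₁)) x₀ =
      -brInv (W ∘L (1 + N₂)) (W ((Q N₂ - Q N₁) (adjoint W (brInv (W ∘L (1 + N₁)) x₀)))) := by
  set z₁ := brInv (W ∘L (1 + N₁)) x₀ with hz₁
  have h := brInv_sub (W ∘L (1 + N₂)) x₀ z₁
  have h1 : brOp (W ∘L (1 + N₁)) z₁ = x₀ := brOp_brInv _ _
  have h2 : brOp (W ∘L (1 + N₂)) z₁ = x₀ + W ((Q N₂ - Q N₁) (adjoint W z₁)) := by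
    rw [brOp_perturb] at h1 ⊢
    rw [← h1, sub_apply, map_sub, add_assoc, add_sub_cancel]
  rw [h2, sub_add_cancel_left, map_neg] at h
  exact h

/-- The change of the resolvent itself: `[ ]_N⁻¹h − [ ]⁻¹h = −[ ]_N⁻¹(W Q(N) W†[ ]⁻¹h)`. [cite: Enflo2023, v2 p.14 (`A⁻¹ → A⁻¹ − A⁻¹BA⁻¹`)] -/
theorem brInv_perturb_sub (W : E →L[ℂ] H) (N : E →L[ℂ] E) (h : H) :
    brInv (W ∘L (1 + N)) h - brInv W h = -brInv (W ∘L (1 + N)) (W (Q N (adjoint W (brInv W h)))) := by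
  rw [brInv_sub, brOp_perturb, brOp_brInv, sub_add_cancel_left, map_neg]

/-! Norms of `Q`. -/

/-- `‖Q(N)‖ ≤ 2‖N‖ + ‖N‖²`. [folklore] -/
theorem norm_Q_le (N : E →L[ℂ] E) : ‖Q N‖ ≤ 2 * ‖N‖ + ‖N‖ ^ 2 := by
  have h1 : ‖adjoint N‖ = ‖N‖ := LinearIsometryEquiv.norm_map _ _
  calc ‖Q N‖ ≤ ‖N‖ + ‖adjoint N‖ + ‖N ∘L adjoint N‖ := norm_add₃_le
    _ ≤ ‖N‖ + ‖adjoint N‖ + ‖N‖ * ‖adjoint N‖ := by gcongr; exact opNorm_comp_le _ _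
    _ = 2 * ‖N‖ + ‖N‖ ^ 2 := by rw [h1]; ring

/-- The linear part of `Q`: `L(Δ) := Δ + Δ†`. [cite: Enflo2023, v2 p.15 (the `B` of (28))] -/
def Lin (Δ : E →L[ℂ] E) : E →L[ℂ] E := Δ + adjoint Δ

/-- `‖L(Δ)‖ ≤ 2‖Δ‖`. [folklore] -/
theorem norm_Lin_le (Δ : E →L[ℂ] E) : ‖Lin Δ‖ ≤ 2 * ‖Δ‖ := by
  have h1 : ‖adjoint Δ‖ = ‖Δ‖ := LinearIsometryEquiv.norm_map _ _
  calc ‖Lin Δ‖ ≤ ‖Δ‖ + ‖adjoint Δ‖ := norm_add_le _ _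
    _ = 2 * ‖Δ‖ := by rw [h1]; ring

/-- `Q(N₂) − Q(N₁) = L(N₂ − N₁) + ((N₂ − N₁)N₂† + N₁(N₂ − N₁)†)`. [folklore] -/
theorem Q_sub_eq (N₁ N₂ : E →L[ℂ] E) :
    Q N₂ - Q N₁ = Lin (N₂ - N₁) + ((N₂ - N₁) ∘L adjoint N₂ + N₁ ∘L adjoint (N₂ - N₁)) := by
  simp only [Q, Lin, map_sub, sub_comp, comp_sub]
  abel

/-- `‖Q(N₂) − Q(N₁) − L(N₂ − N₁)‖ ≤ (‖N₁‖ + ‖N₂‖)‖N₂ − N₁‖`. [folklore] -/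
theorem norm_Q_sub_sub_Lin_le (N₁ N₂ : E →L[ℂ] E) :
    ‖Q N₂ - Q N₁ - Lin (N₂ - N₁)‖ ≤ (‖N₁‖ + ‖N₂‖) * ‖N₂ - N₁‖ := by
  rw [Q_sub_eq, add_sub_cancel_left]
  have h1 : ‖adjoint N₂‖ = ‖N₂‖ := LinearIsometryEquiv.norm_map _ _
  have h2 : ‖adjoint (N₂ - N₁)‖ = ‖N₂ - N₁‖ := LinearIsometryEquiv.norm_map _ _
  calc ‖(N₂ - N₁) ∘L adjoint N₂ + N₁ ∘L adjoint (N₂ - N₁)‖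
      ≤ ‖N₂ - N₁‖ * ‖adjoint N₂‖ + ‖N₁‖ * ‖adjoint (N₂ - N₁)‖ :=
        (norm_add_le _ _).trans (add_le_add (opNorm_comp_le _ _) (opNorm_comp_le _ _))
    _ = (‖N₁‖ + ‖N₂‖) * ‖N₂ - N₁‖ := by rw [h1, h2]; ring

/-- `‖Q(N₂) − Q(N₁)‖ ≤ (2 + ‖N₁‖ + ‖N₂‖)‖N₂ − N₁‖`. [folklore] -/
theorem norm_Q_sub_le (N₁ N₂ : E →L[ℂ] E) :
    ‖Q N₂ - Q N₁‖ ≤ (2 + ‖N₁‖ + ‖N₂‖) * ‖N₂ - N₁‖ := by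
  have h1 := norm_Q_sub_sub_Lin_le N₁ N₂
  have h2 := norm_Lin_le (N₂ - N₁)
  have h3 : ‖Q N₂ - Q N₁‖ ≤ ‖Q N₂ - Q N₁ - Lin (N₂ - N₁)‖ + ‖Lin (N₂ - N₁)‖ := by
    have := norm_add_le (Q N₂ - Q N₁ - Lin (N₂ - N₁)) (Lin (N₂ - N₁))
    rwa [sub_add_cancel] at this
  nlinarith

omit [CompleteSpace E] in
/-- The generic bilinear difference bound used for every functional below:
`|⟪p', B q'⟫ − ⟪p, A q⟫| ≤ ‖p' − p‖‖B‖‖q'‖ + ‖p‖‖B − A‖‖q'‖ + ‖p‖‖A‖‖q' − q‖`. [folklore] -/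
theorem norm_inner_bilin_sub_le (p p' q q' : E) (A B : E →L[ℂ] E) :
    ‖⟪p', B q'⟫_ℂ - ⟪p, A q⟫_ℂ‖ ≤
      ‖p' - p‖ * ‖B‖ * ‖q'‖ + ‖p‖ * ‖B - A‖ * ‖q'‖ + ‖p‖ * ‖A‖ * ‖q' - q‖ := by
  have h : ⟪p', B q'⟫_ℂ - ⟪p, A q⟫_ℂ = ⟪p' - p, B q'⟫_ℂ + ⟪p, (B - A) q'⟫_ℂ + ⟪p, A (q' - q)⟫_ℂ := by
    simp only [inner_sub_left, inner_sub_right, sub_apply, map_sub]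
    ring
  rw [h]
  have key : ∀ (x y : E) (M : E →L[ℂ] E), ‖⟪x, M y⟫_ℂ‖ ≤ ‖x‖ * ‖M‖ * ‖y‖ := fun x y M =>
    (norm_inner_le_norm _ _).trans (by rw [mul_assoc]; gcongr; exact le_opNorm _ _)
  exact norm_add₃_le.trans (add_le_add (add_le_add (key _ _ _) (key _ _ _)) (key _ _ _))

/-! ### C. The three step functionals ((45) drift, (46) side condition, (b') decrease), their first-order parts,
and the two-point remainder estimates -/

omit [CompleteSpace H] in
/-- `(εθ)(v) := Re⟪v, x₀ − v⟫` of an MC vector `v` (v2 (16): `= ‖ℓ‖²` at a bracket point). [cite: Enflo2023, v2 (16), p.6] -/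
def eth (x₀ v : H) : ℝ := (⟪v, x₀ - v⟫_ℂ).re

omit [CompleteSpace H] in
/-- (31) exact, in the form used below: `(εθ)(v + δ) − (εθ)(v) = Re⟪x₀, δ⟫ − 2Re⟪v, δ⟫ − ‖δ‖²`. [cite: Enflo2023, v2 (31), p.16] -/
lemma eth_add_sub_eth (x₀ v δ : H) :
    eth x₀ (v + δ) - eth x₀ v = (⟪x₀, δ⟫_ℂ).re - 2 * (⟪v, δ⟫_ℂ).re - ‖δ‖ ^ 2 := by
  have h1 : (⟪δ, x₀⟫_ℂ).re = (⟪x₀, δ⟫_ℂ).re := by simpa using inner_re_symm (𝕜 := ℂ) δ x₀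
  have h2 : (⟪δ, v⟫_ℂ).re = (⟪v, δ⟫_ℂ).re := by simpa using inner_re_symm (𝕜 := ℂ) δ v
  have h3 : (⟪δ, δ⟫_ℂ).re = ‖δ‖ ^ 2 := by rw [inner_self_eq_coe_norm_sq, Complex.ofReal_re]
  simp only [eth, inner_add_left, inner_add_right, inner_sub_right, Complex.add_re, Complex.sub_re]
  linarith [h1, h2, h3]

/-- At a bracket point `(εθ) = ‖W'†z‖²` ((16)). [cite: Enflo2023, v2 (16), p.6] -/
lemma eth_eq_of_isBracket {W' : E →L[ℂ] H} {x₀ z : H} (h : IsBracket W' x₀ z) :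
    eth x₀ z = ‖adjoint W' z‖ ^ 2 := by
  rw [eth, h.norm_sq_ell, h.sub_eq, eq_sub_of_add_eq' h]

/-- At a bracket point `‖z‖² = Re⟪z, x₀⟫ − (εθ)` ((16): `Re⟨v, x₀⟩ = ‖v‖² + (εθ)`). [cite: Enflo2023, v2 (16), p.6] -/
lemma norm_sq_eq_of_isBracket {W' : E →L[ℂ] H} {x₀ z : H} (h : IsBracket W' x₀ z) :
    ‖z‖ ^ 2 = (⟪z, x₀⟫_ℂ).re - eth x₀ z := by
  rw [eth_eq_of_isBracket h, h.inner_self_x₀, Complex.ofReal_re]; ring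

/-- For `‖N‖ ≤ 1/10`: `(9/10)‖W†w‖ ≤ ‖(W(1+N))†w‖`. [folklore] -/
lemma hμ_of_norm_le {W : E →L[ℂ] H} {N : E →L[ℂ] E} (hN : ‖N‖ ≤ 1 / 10) (w : H) :
    (9 / 10 : ℝ) * ‖adjoint W w‖ ≤ ‖adjoint (W ∘L (1 + N)) w‖ := by
  have := adjoint_perturb_lower W hN w
  norm_num at this ⊢
  exact this

section Estimates

variable (W : E →L[ℂ] H) (x₀ : H)

/-- The energy bounds at `μ = 9/10` (valid for `‖N‖ ≤ 1/10`), in polynomial form. [folklore] -/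
lemma bounds_pert {N : E →L[ℂ] E} (hN : ‖N‖ ≤ 1 / 10) (b : E) (u : H) :
    ‖brInv (W ∘L (1 + N)) (W b)‖ ≤ 5 / 9 * ‖b‖ ∧
      ‖adjoint W (brInv (W ∘L (1 + N)) (W b))‖ ≤ 100 / 81 * ‖b‖ ∧
      ‖adjoint W (brInv (W ∘L (1 + N)) u)‖ ≤ 5 / 9 * ‖u‖ := by
  have h := norm_brInv_map_le (W := W) (W' := W ∘L (1 + N)) (μ := 9 / 10) (by norm_num)
    (hμ_of_norm_le hN) b
  have h' := norm_adjoint_brInv_le (W := W) (W' := W ∘L (1 + N)) (μ := 9 / 10) (by norm_num)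
    (hμ_of_norm_le hN) u
  refine ⟨h.1.trans_eq (by ring), h.2.trans_eq (by ring), h'.trans_eq (by ring)⟩

/-- The energy bounds at `μ = 1` (no step), in polynomial form. [folklore] -/
lemma bounds_base (b : E) (u : H) :
    ‖brInv W (W b)‖ ≤ 1 / 2 * ‖b‖ ∧ ‖adjoint W (brInv W (W b))‖ ≤ ‖b‖ ∧
      ‖adjoint W (brInv W u)‖ ≤ 1 / 2 * ‖u‖ := by
  have h := norm_brInv_map_le (W := W) (W' := W) (μ := 1) one_pos (adjoint_self_lower W) b
  have h' := norm_adjoint_brInv_le (W := W) (W' := W) (μ := 1) one_pos (adjoint_self_lower W) u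
  refine ⟨h.1.trans_eq (by ring), h.2.trans_eq (by ring), h'.trans_eq (by ring)⟩

/-- `z := [ ]⁻¹x₀`, the MC vector of the (normalised) state. [cite: Enflo2023, v2 (15), p.6] -/
def bz : H := brInv W x₀

/-- `ℓ := W†[ ]⁻¹x₀` ((17)); `‖ℓ‖² = (εθ)` by (16). [cite: Enflo2023, v2 (16)–(17), p.6] -/
def ba : E := adjoint W (bz W x₀)

/-- `z_N := [ ]_N⁻¹x₀`, the MC vector after the step `W → W(1+N)` (`y → y + r(T)y`, v2 p.16). [cite: Enflo2023, v2 p.16–17] -/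
def zN (N : E →L[ℂ] E) : H := brInv (W ∘L (1 + N)) x₀

/-- `N = 0` is no step. [folklore] -/
@[simp] lemma zN_zero : zN W x₀ 0 = bz W x₀ := by
  rw [zN, bz, perturb_zero]

/-- `z` is the bracket point of `W`. [cite: Enflo2023, v2 (15), p.6] -/
lemma isBracket_bz : IsBracket W x₀ (bz W x₀) := isBracket_brInv W x₀

/-- `z_N` is the bracket point of `W(1+N)`. [cite: Enflo2023, v2 (15), p.6] -/
lemma isBracket_zN (N : E →L[ℂ] E) : IsBracket (W ∘L (1 + N)) x₀ (zN W x₀ N) := isBracket_brInv _ x₀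

/-- `(εθ) = ‖ℓ‖²`. [cite: Enflo2023, v2 (16), p.6] -/
lemma eth_bz : eth x₀ (bz W x₀) = ‖ba W x₀‖ ^ 2 := eth_eq_of_isBracket (isBracket_bz W x₀)

/-- `‖Q(N)‖ ≤ 3r` for `‖N‖ ≤ r ≤ 1/10`. [folklore] -/
lemma norm_Q_le_three {N : E →L[ℂ] E} {r : ℝ} (hN : ‖N‖ ≤ r) (hr : r ≤ 1 / 10) : ‖Q N‖ ≤ 3 * r := by
  have h := norm_Q_le N
  have h0 : 0 ≤ ‖N‖ := norm_nonneg _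
  nlinarith

/-- `‖Q(N₂) − Q(N₁)‖ ≤ 3‖N₂ − N₁‖` for `‖Nᵢ‖ ≤ 1/10`. [folklore] -/
lemma norm_Q_sub_le_three {N₁ N₂ : E →L[ℂ] E} (h₁ : ‖N₁‖ ≤ 1 / 10) (h₂ : ‖N₂‖ ≤ 1 / 10) :
    ‖Q N₂ - Q N₁‖ ≤ 3 * ‖N₂ - N₁‖ := by
  have := norm_Q_sub_le N₁ N₂
  nlinarith [norm_nonneg (N₂ - N₁)]

/-- The displacement of one step: `‖z_N − z‖ ≤ 2r‖ℓ‖` and `‖W†(z_N − z)‖ ≤ 4r‖ℓ‖` for `‖N‖ ≤ r ≤ 1/10`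
(both `O(‖N‖(εθ)^{1/2})` — the text's "first order change"). [cite: Enflo2023, v2 p.14–17, (28), (38)] -/
lemma norm_D_le {N : E →L[ℂ] E} {r : ℝ} (hN : ‖N‖ ≤ r) (hr : r ≤ 1 / 10) :
    ‖zN W x₀ N - bz W x₀‖ ≤ 2 * r * ‖ba W x₀‖ ∧
      ‖adjoint W (zN W x₀ N - bz W x₀)‖ ≤ 4 * r * ‖ba W x₀‖ := by
  have hQ := norm_Q_le_three hN hr
  have hr0 : 0 ≤ r := (norm_nonneg _).trans hN
  have hA := norm_nonneg (ba W x₀)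
  have hb : ‖Q N (ba W x₀)‖ ≤ 3 * r * ‖ba W x₀‖ := (le_opNorm _ _).trans (by gcongr)
  have hstep : zN W x₀ N - bz W x₀ = -brInv (W ∘L (1 + N)) (W (Q N (ba W x₀))) := step_sub_eq W N x₀
  have h := bounds_pert W (hN.trans hr) (Q N (ba W x₀)) x₀
  rw [hstep, norm_neg, map_neg, norm_neg]
  constructor
  · nlinarith [h.1, mul_nonneg hr0 hA]
  · nlinarith [h.2.1, mul_nonneg hr0 hA]

/-- `‖W†z_N‖ ≤ 2‖ℓ‖` for `‖N‖ ≤ r ≤ 1/10`. [folklore] -/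
lemma norm_adjoint_zN_le {N : E →L[ℂ] E} {r : ℝ} (hN : ‖N‖ ≤ r) (hr : r ≤ 1 / 10) :
    ‖adjoint W (zN W x₀ N)‖ ≤ 2 * ‖ba W x₀‖ := by
  have h := (norm_D_le W x₀ hN hr).2
  have hr0 : 0 ≤ r := (norm_nonneg _).trans hN
  have h1 : adjoint W (zN W x₀ N) = ba W x₀ + adjoint W (zN W x₀ N - bz W x₀) := by
    rw [map_sub, ba, add_sub_cancel]
  rw [h1]
  calc ‖ba W x₀ + adjoint W (zN W x₀ N - bz W x₀)‖ ≤ ‖ba W x₀‖ + 4 * r * ‖ba W x₀‖ :=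
        (norm_add_le _ _).trans (by gcongr)
    _ ≤ 2 * ‖ba W x₀‖ := by nlinarith [norm_nonneg (ba W x₀)]

/-- The two-point displacement: `‖z_{N₂} − z_{N₁}‖ ≤ 4‖ℓ‖‖N₂ − N₁‖` for `‖Nᵢ‖ ≤ r ≤ 1/10`. [folklore] -/
lemma norm_delta_le {N₁ N₂ : E →L[ℂ] E} {r : ℝ} (h₁ : ‖N₁‖ ≤ r) (h₂ : ‖N₂‖ ≤ r) (hr : r ≤ 1 / 10) :
    ‖zN W x₀ N₂ - zN W x₀ N₁‖ ≤ 4 * ‖ba W x₀‖ * ‖N₂ - N₁‖ := by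
  have hΔQ := norm_Q_sub_le_three (h₁.trans hr) (h₂.trans hr)
  have hw₁ := norm_adjoint_zN_le W x₀ h₁ hr
  have hb : ‖(Q N₂ - Q N₁) (adjoint W (zN W x₀ N₁))‖ ≤ 3 * ‖N₂ - N₁‖ * (2 * ‖ba W x₀‖) :=
    (le_opNorm _ _).trans (mul_le_mul hΔQ hw₁ (norm_nonneg _) (by positivity))
  have h := (bounds_pert W (h₂.trans hr) ((Q N₂ - Q N₁) (adjoint W (zN W x₀ N₁))) x₀).1
  have hδ : zN W x₀ N₂ - zN W x₀ N₁ =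
      -brInv (W ∘L (1 + N₂)) (W ((Q N₂ - Q N₁) (adjoint W (zN W x₀ N₁)))) :=
    two_point_sub_eq W N₁ N₂ x₀
  rw [hδ, norm_neg]
  nlinarith [mul_nonneg (norm_nonneg (N₂ - N₁)) (norm_nonneg (ba W x₀))]

/-- `κ := W†[ ]⁻¹c` (the vector through which the side-condition functional `⟨·, c⟩` sees a step). [cite: Enflo2023, v2 (46), p.19] -/
def bκ (c : H) : E := adjoint W (brInv W c)

/-- `π_{N,N'} := W†[ ]_N⁻¹(x₀ − 2z_{N'})` (the vector through which `(εθ)` sees a step, cf. (31) `⟨ch v, x₀ − 2v⟩`). [cite: Enflo2023, v2 (31), p.16] -/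
def bπ (N N' : E →L[ℂ] E) : E := adjoint W (brInv (W ∘L (1 + N)) (x₀ - (2 : ℂ) • zN W x₀ N'))

/-- `‖κ‖ ≤ ‖c‖/2`. [folklore] -/
lemma norm_bκ_le (c : H) : ‖bκ W c‖ ≤ 1 / 2 * ‖c‖ := (bounds_base W (0 : E) c).2.2

/-- `‖κ_{N} − κ‖ ≤ 2r‖c‖` where `κ_N := W†[ ]_N⁻¹c`, for `‖N‖ ≤ r ≤ 1/10`. [folklore] -/
lemma norm_bκ_sub_le {N : E →L[ℂ] E} {r : ℝ} (hN : ‖N‖ ≤ r) (hr : r ≤ 1 / 10) (c : H) :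
    ‖adjoint W (brInv (W ∘L (1 + N)) c) - bκ W c‖ ≤ 2 * r * ‖c‖ := by
  have hr0 : 0 ≤ r := (norm_nonneg _).trans hN
  have hQ := norm_Q_le_three hN hr
  have h1 : adjoint W (brInv (W ∘L (1 + N)) c) - bκ W c =
      -adjoint W (brInv (W ∘L (1 + N)) (W (Q N (bκ W c)))) := by
    rw [bκ, ← map_sub, brInv_perturb_sub, map_neg]
  have hb : ‖Q N (bκ W c)‖ ≤ 3 * r * (1 / 2 * ‖c‖) :=
    (le_opNorm _ _).trans (mul_le_mul hQ (norm_bκ_le W c) (norm_nonneg _) (by positivity))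
  have h := (bounds_pert W (hN.trans hr) (Q N (bκ W c)) c).2.1
  rw [h1, norm_neg]
  nlinarith [mul_nonneg hr0 (norm_nonneg c)]

/-- `W†[ ]⁻¹z = ℓ − W†[ ]⁻¹Wℓ`, so `‖W†[ ]⁻¹z‖ ≤ 2‖ℓ‖`. [folklore] -/
lemma norm_adjoint_brInv_bz_le : ‖adjoint W (brInv W (bz W x₀))‖ ≤ 2 * ‖ba W x₀‖ := by
  have h1 : brInv W (bz W x₀) = brInv W x₀ - brInv W (W (ba W x₀)) := by
    rw [← map_sub, ba, (isBracket_bz W x₀).sub_eq]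
  have h2 : adjoint W (brInv W (bz W x₀)) = ba W x₀ - adjoint W (brInv W (W (ba W x₀))) := by
    rw [h1, map_sub]; rfl
  have h3 := (bounds_base W (ba W x₀) x₀).2.1
  rw [h2]
  calc _ ≤ ‖ba W x₀‖ + ‖adjoint W (brInv W (W (ba W x₀)))‖ := norm_sub_le _ _
    _ ≤ 2 * ‖ba W x₀‖ := by linarith

/-- `π_0 = ℓ − 2W†[ ]⁻¹z` and `‖π_0‖ ≤ 5‖ℓ‖`. [folklore] -/
lemma norm_bπ_zero_le : ‖bπ W x₀ 0 0‖ ≤ 5 * ‖ba W x₀‖ := by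
  have h0 : bπ W x₀ 0 0 = ba W x₀ - (2 : ℂ) • adjoint W (brInv W (bz W x₀)) := by
    rw [bπ, perturb_zero, zN_zero, map_sub, map_smul, map_sub, map_smul]; rfl
  have h1 := norm_adjoint_brInv_bz_le W x₀
  rw [h0]
  calc _ ≤ ‖ba W x₀‖ + ‖(2 : ℂ) • adjoint W (brInv W (bz W x₀))‖ := norm_sub_le _ _
    _ ≤ ‖ba W x₀‖ + 2 * (2 * ‖ba W x₀‖) := by rw [norm_smul, RCLike.norm_ofNat]; gcongr
    _ = 5 * ‖ba W x₀‖ := by ring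

/-- `‖π_N − π_0‖ ≤ 22r‖ℓ‖` for `‖N‖ ≤ r ≤ 1/10`. [folklore] -/
lemma norm_bπ_sub_le {N N' : E →L[ℂ] E} {r : ℝ} (hN : ‖N‖ ≤ r) (hN' : ‖N'‖ ≤ r) (hr : r ≤ 1 / 10) :
    ‖bπ W x₀ N N' - bπ W x₀ 0 0‖ ≤ 22 * r * ‖ba W x₀‖ := by
  have hr0 : 0 ≤ r := (norm_nonneg _).trans hN
  have hQ := norm_Q_le_three hN hr
  have hD := (norm_D_le W x₀ hN' hr).1
  have hπ0 := norm_bπ_zero_le W x₀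
  have hA := norm_nonneg (ba W x₀)
  have hπ0' : bπ W x₀ 0 0 = adjoint W (brInv W (x₀ - (2 : ℂ) • bz W x₀)) := by
    rw [bπ, perturb_zero, zN_zero]
  have hsplit : bπ W x₀ N N' - bπ W x₀ 0 0 =
      adjoint W (brInv (W ∘L (1 + N)) (x₀ - (2 : ℂ) • zN W x₀ N') - brInv W (x₀ - (2 : ℂ) • zN W x₀ N')) +
        adjoint W (brInv W ((x₀ - (2 : ℂ) • zN W x₀ N') - (x₀ - (2 : ℂ) • bz W x₀))) := by
    rw [bπ, hπ0']
    simp only [map_sub, map_smul]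
    abel
  have hh : (x₀ - (2 : ℂ) • zN W x₀ N') - (x₀ - (2 : ℂ) • bz W x₀) = -((2 : ℂ) • (zN W x₀ N' - bz W x₀)) := by
    rw [smul_sub]; abel
  have hp2 : ‖adjoint W (brInv W ((x₀ - (2 : ℂ) • zN W x₀ N') - (x₀ - (2 : ℂ) • bz W x₀)))‖ ≤
      2 * r * ‖ba W x₀‖ := by
    have := (bounds_base W (0 : E) ((x₀ - (2 : ℂ) • zN W x₀ N') - (x₀ - (2 : ℂ) • bz W x₀))).2.2
    have hn : ‖(x₀ - (2 : ℂ) • zN W x₀ N') - (x₀ - (2 : ℂ) • bz W x₀)‖ = 2 * ‖zN W x₀ N' - bz W x₀‖ := by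
      rw [hh, norm_neg, norm_smul, RCLike.norm_ofNat]
    rw [hn] at this
    linarith
  have hRh₁ : ‖adjoint W (brInv W (x₀ - (2 : ℂ) • zN W x₀ N'))‖ ≤ 5 * ‖ba W x₀‖ + 2 * r * ‖ba W x₀‖ := by
    have : adjoint W (brInv W (x₀ - (2 : ℂ) • zN W x₀ N')) = bπ W x₀ 0 0 +
        adjoint W (brInv W ((x₀ - (2 : ℂ) • zN W x₀ N') - (x₀ - (2 : ℂ) • bz W x₀))) := by
      rw [hπ0', ← map_add, ← map_add, add_sub_cancel]
    rw [this]
    exact (norm_add_le _ _).trans (add_le_add hπ0 hp2)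
  have hp1 : ‖adjoint W (brInv (W ∘L (1 + N)) (x₀ - (2 : ℂ) • zN W x₀ N') -
      brInv W (x₀ - (2 : ℂ) • zN W x₀ N'))‖ ≤ 20 * r * ‖ba W x₀‖ := by
    rw [brInv_perturb_sub, map_neg, norm_neg]
    have h := (bounds_pert W (hN.trans hr)
      (Q N (adjoint W (brInv W (x₀ - (2 : ℂ) • zN W x₀ N')))) x₀).2.1
    have hb : ‖Q N (adjoint W (brInv W (x₀ - (2 : ℂ) • zN W x₀ N')))‖ ≤
        3 * r * (5 * ‖ba W x₀‖ + 2 * r * ‖ba W x₀‖) :=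
      (le_opNorm _ _).trans (mul_le_mul hQ hRh₁ (norm_nonneg _) (by positivity))
    nlinarith [mul_nonneg hr0 hA, mul_nonneg (mul_nonneg hr0 hr0) hA]
  rw [hsplit]
  calc _ ≤ 20 * r * ‖ba W x₀‖ + 2 * r * ‖ba W x₀‖ := (norm_add_le _ _).trans (add_le_add hp1 hp2)
    _ = 22 * r * ‖ba W x₀‖ := by ring

/-! The exact two-point expressions of the three functionals. -/

/-- Drift: `⟪x₀, z₂ − z₁⟫ = −⟪W†z₂, (Q₂ − Q₁)W†z₁⟫`. [cite: Enflo2023, v2 (28), (38), (45)] -/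
lemma drift_two_point (N₁ N₂ : E →L[ℂ] E) :
    ⟪x₀, zN W x₀ N₂ - zN W x₀ N₁⟫_ℂ =
      -⟪adjoint W (zN W x₀ N₂), (Q N₂ - Q N₁) (adjoint W (zN W x₀ N₁))⟫_ℂ := by
  have hδ : zN W x₀ N₂ - zN W x₀ N₁ =
      -brInv (W ∘L (1 + N₂)) (W ((Q N₂ - Q N₁) (adjoint W (zN W x₀ N₁)))) :=
    two_point_sub_eq W N₁ N₂ x₀
  rw [hδ, inner_neg_right, inner_brInv_comm, adjoint_inner_left]
  rfl

/-- Side condition: `⟪c, z₂ − z₁⟫ = −⟪W†[ ]₂⁻¹c, (Q₂ − Q₁)W†z₁⟫`. [cite: Enflo2023, v2 (46), p.19] -/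
lemma side_two_point (c : H) (N₁ N₂ : E →L[ℂ] E) :
    ⟪c, zN W x₀ N₂ - zN W x₀ N₁⟫_ℂ =
      -⟪adjoint W (brInv (W ∘L (1 + N₂)) c), (Q N₂ - Q N₁) (adjoint W (zN W x₀ N₁))⟫_ℂ := by
  have hδ : zN W x₀ N₂ - zN W x₀ N₁ =
      -brInv (W ∘L (1 + N₂)) (W ((Q N₂ - Q N₁) (adjoint W (zN W x₀ N₁)))) :=
    two_point_sub_eq W N₁ N₂ x₀
  rw [hδ, inner_neg_right, inner_brInv_comm, adjoint_inner_left]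

/-- Decrease: `(εθ)₂ − (εθ)₁ = −Re⟪π_{2,1}, (Q₂ − Q₁)W†z₁⟫ − ‖z₂ − z₁‖²`, `π_{2,1} = W†[ ]₂⁻¹(x₀ − 2z₁)`. [cite: Enflo2023, v2 (31), p.16] -/
lemma eth_two_point (N₁ N₂ : E →L[ℂ] E) :
    eth x₀ (zN W x₀ N₂) - eth x₀ (zN W x₀ N₁) =
      -(⟪bπ W x₀ N₂ N₁, (Q N₂ - Q N₁) (adjoint W (zN W x₀ N₁))⟫_ℂ).re - ‖zN W x₀ N₂ - zN W x₀ N₁‖ ^ 2 := by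
  set δ := zN W x₀ N₂ - zN W x₀ N₁ with hδ
  have h0 : zN W x₀ N₂ = zN W x₀ N₁ + δ := by rw [hδ, add_sub_cancel]
  have h1 := eth_add_sub_eth x₀ (zN W x₀ N₁) δ
  rw [← h0] at h1
  rw [h1]
  have h2 : ⟪x₀ - (2 : ℂ) • zN W x₀ N₁, δ⟫_ℂ = ⟪x₀, δ⟫_ℂ - 2 * ⟪zN W x₀ N₁, δ⟫_ℂ := by
    rw [inner_sub_left, inner_smul_left, map_ofNat]
  have h3 : ⟪x₀ - (2 : ℂ) • zN W x₀ N₁, δ⟫_ℂ =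
      -⟪bπ W x₀ N₂ N₁, (Q N₂ - Q N₁) (adjoint W (zN W x₀ N₁))⟫_ℂ := by
    have hδ' : δ = -brInv (W ∘L (1 + N₂)) (W ((Q N₂ - Q N₁) (adjoint W (zN W x₀ N₁)))) :=
      two_point_sub_eq W N₁ N₂ x₀
    rw [hδ', inner_neg_right, inner_brInv_comm, bπ, adjoint_inner_left]
  have h4 := congrArg Complex.re (h2.symm.trans h3)
  simp only [Complex.sub_re, Complex.neg_re, Complex.mul_re, Complex.re_ofNat, Complex.im_ofNat, zero_mul,
    sub_zero] at h4
  linarith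

/-! ### D. The remainder estimates: `|F(N₂) − F(N₁) − Λ(N₂ − N₁)| ≤ K·r·scale·‖N₂ − N₁‖` on `‖Nᵢ‖ ≤ r ≤ 1/10` -/

/-- monotonicity of a triple product of norms. [folklore] -/
lemma norm_mul3_le {α β γ : Type*} [SeminormedAddCommGroup α] [SeminormedAddCommGroup β]
    [SeminormedAddCommGroup γ] {x : α} {y : β} {z : γ} {a' b' c' : ℝ} (h1 : ‖x‖ ≤ a') (h2 : ‖y‖ ≤ b')
    (h3 : ‖z‖ ≤ c') : ‖x‖ * ‖y‖ * ‖z‖ ≤ a' * b' * c' :=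
  mul_le_mul (mul_le_mul h1 h2 (norm_nonneg _) ((norm_nonneg _).trans h1)) h3 (norm_nonneg _)
    (mul_nonneg ((norm_nonneg _).trans h1) ((norm_nonneg _).trans h2))

/-- `‖(Q₂ − Q₁) − Lin(N₂ − N₁)‖ ≤ 2r‖N₂ − N₁‖`. [folklore] -/
lemma norm_Q_sub_sub_Lin_le_two {N₁ N₂ : E →L[ℂ] E} {r : ℝ} (h₁ : ‖N₁‖ ≤ r) (h₂ : ‖N₂‖ ≤ r) :
    ‖Q N₂ - Q N₁ - Lin (N₂ - N₁)‖ ≤ 2 * r * ‖N₂ - N₁‖ := by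
  have := norm_Q_sub_sub_Lin_le N₁ N₂
  nlinarith [norm_nonneg (N₂ - N₁)]

/-- (E1) Drift remainder: `|Re⟪x₀, z₂ − z₁⟫ + Re⟪ℓ, Lin(N₂−N₁)ℓ⟫| ≤ 36 r ‖ℓ‖² ‖N₂ − N₁‖`.
[cite: Enflo2023, v2 (38), (45), p.16–19] -/
lemma drift_remainder {N₁ N₂ : E →L[ℂ] E} {r : ℝ} (h₁ : ‖N₁‖ ≤ r) (h₂ : ‖N₂‖ ≤ r) (hr : r ≤ 1 / 10) :
    |(⟪x₀, zN W x₀ N₂ - zN W x₀ N₁⟫_ℂ).re + (⟪ba W x₀, Lin (N₂ - N₁) (ba W x₀)⟫_ℂ).re| ≤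
      36 * r * ‖ba W x₀‖ ^ 2 * ‖N₂ - N₁‖ := by
  have hr0 : 0 ≤ r := (norm_nonneg _).trans h₁
  have hA := norm_nonneg (ba W x₀)
  have hG₁ := (norm_D_le W x₀ h₁ hr).2
  have hG₂ := (norm_D_le W x₀ h₂ hr).2
  have hw₁ := norm_adjoint_zN_le W x₀ h₁ hr
  have hΔQ := norm_Q_sub_le_three (h₁.trans hr) (h₂.trans hr)
  have hQL := norm_Q_sub_sub_Lin_le_two h₁ h₂
  have hL := norm_Lin_le (N₂ - N₁)
  have hp : ‖adjoint W (zN W x₀ N₂) - ba W x₀‖ ≤ 4 * r * ‖ba W x₀‖ := by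
    rw [ba, ← map_sub]; exact hG₂
  have hq : ‖adjoint W (zN W x₀ N₁) - ba W x₀‖ ≤ 4 * r * ‖ba W x₀‖ := by
    rw [ba, ← map_sub]; exact hG₁
  have key := norm_inner_bilin_sub_le (ba W x₀) (adjoint W (zN W x₀ N₂)) (ba W x₀) (adjoint W (zN W x₀ N₁))
    (Lin (N₂ - N₁)) (Q N₂ - Q N₁)
  rw [drift_two_point, Complex.neg_re, neg_add_eq_sub, abs_sub_comm]
  calc _ = |(⟪adjoint W (zN W x₀ N₂), (Q N₂ - Q N₁) (adjoint W (zN W x₀ N₁))⟫_ℂ -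
        ⟪ba W x₀, Lin (N₂ - N₁) (ba W x₀)⟫_ℂ).re| := by rw [Complex.sub_re]
    _ ≤ ‖⟪adjoint W (zN W x₀ N₂), (Q N₂ - Q N₁) (adjoint W (zN W x₀ N₁))⟫_ℂ -
        ⟪ba W x₀, Lin (N₂ - N₁) (ba W x₀)⟫_ℂ‖ := Complex.abs_re_le_norm _
    _ ≤ _ := key
    _ ≤ 4 * r * ‖ba W x₀‖ * (3 * ‖N₂ - N₁‖) * (2 * ‖ba W x₀‖) +
        ‖ba W x₀‖ * (2 * r * ‖N₂ - N₁‖) * (2 * ‖ba W x₀‖) +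
        ‖ba W x₀‖ * (2 * ‖N₂ - N₁‖) * (4 * r * ‖ba W x₀‖) :=
      add_le_add_three
        (norm_mul3_le hp hΔQ hw₁)
        (norm_mul3_le le_rfl hQL hw₁)
        (norm_mul3_le le_rfl hL hq)
    _ = 36 * r * ‖ba W x₀‖ ^ 2 * ‖N₂ - N₁‖ := by ring

/-- (E2) Side-condition remainder: `‖⟪c, z₂ − z₁⟫ + ⟪κ, Lin(N₂−N₁)ℓ⟫‖ ≤ 18 r ‖c‖‖ℓ‖‖N₂ − N₁‖`.
[cite: Enflo2023, v2 (37), (46), p.16–19] -/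
lemma side_remainder (c : H) {N₁ N₂ : E →L[ℂ] E} {r : ℝ} (h₁ : ‖N₁‖ ≤ r) (h₂ : ‖N₂‖ ≤ r)
    (hr : r ≤ 1 / 10) :
    ‖⟪c, zN W x₀ N₂ - zN W x₀ N₁⟫_ℂ + ⟪bκ W c, Lin (N₂ - N₁) (ba W x₀)⟫_ℂ‖ ≤
      18 * r * ‖c‖ * ‖ba W x₀‖ * ‖N₂ - N₁‖ := by
  have hr0 : 0 ≤ r := (norm_nonneg _).trans h₁
  have hA := norm_nonneg (ba W x₀)
  have hG₁ := (norm_D_le W x₀ h₁ hr).2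
  have hw₁ := norm_adjoint_zN_le W x₀ h₁ hr
  have hΔQ := norm_Q_sub_le_three (h₁.trans hr) (h₂.trans hr)
  have hQL := norm_Q_sub_sub_Lin_le_two h₁ h₂
  have hL := norm_Lin_le (N₂ - N₁)
  have hκ := norm_bκ_le W c
  have hκ₂ := norm_bκ_sub_le W h₂ hr c
  have hq : ‖adjoint W (zN W x₀ N₁) - ba W x₀‖ ≤ 4 * r * ‖ba W x₀‖ := by
    rw [ba, ← map_sub]; exact hG₁
  have key := norm_inner_bilin_sub_le (bκ W c) (adjoint W (brInv (W ∘L (1 + N₂)) c))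
    (ba W x₀) (adjoint W (zN W x₀ N₁)) (Lin (N₂ - N₁)) (Q N₂ - Q N₁)
  rw [side_two_point, neg_add_eq_sub, norm_sub_rev]
  calc _ ≤ _ := key
    _ ≤ 2 * r * ‖c‖ * (3 * ‖N₂ - N₁‖) * (2 * ‖ba W x₀‖) +
        1 / 2 * ‖c‖ * (2 * r * ‖N₂ - N₁‖) * (2 * ‖ba W x₀‖) +
        1 / 2 * ‖c‖ * (2 * ‖N₂ - N₁‖) * (4 * r * ‖ba W x₀‖) :=
      add_le_add_three
        (norm_mul3_le hκ₂ hΔQ hw₁)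
        (norm_mul3_le hκ hQL hw₁)
        (norm_mul3_le hκ hL hq)
    _ = 18 * r * ‖c‖ * ‖ba W x₀‖ * ‖N₂ - N₁‖ := by ring

/-- (E3) Decrease remainder: `|(εθ)₂ − (εθ)₁ + Re⟪π₀, Lin(N₂−N₁)ℓ⟫| ≤ 224 r ‖ℓ‖² ‖N₂ − N₁‖`
(includes the quadratic term `‖z₂ − z₁‖²` of (31)). [cite: Enflo2023, v2 (31), (36), p.16] -/
lemma eth_remainder {N₁ N₂ : E →L[ℂ] E} {r : ℝ} (h₁ : ‖N₁‖ ≤ r) (h₂ : ‖N₂‖ ≤ r) (hr : r ≤ 1 / 10) :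
    |eth x₀ (zN W x₀ N₂) - eth x₀ (zN W x₀ N₁) + (⟪bπ W x₀ 0 0, Lin (N₂ - N₁) (ba W x₀)⟫_ℂ).re| ≤
      224 * r * ‖ba W x₀‖ ^ 2 * ‖N₂ - N₁‖ := by
  have hr0 : 0 ≤ r := (norm_nonneg _).trans h₁
  have hA := norm_nonneg (ba W x₀)
  have hG₁ := (norm_D_le W x₀ h₁ hr).2
  have hw₁ := norm_adjoint_zN_le W x₀ h₁ hr
  have hΔQ := norm_Q_sub_le_three (h₁.trans hr) (h₂.trans hr)
  have hQL := norm_Q_sub_sub_Lin_le_two h₁ h₂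
  have hL := norm_Lin_le (N₂ - N₁)
  have hπ := norm_bπ_zero_le W x₀
  have hπ₂ := norm_bπ_sub_le W x₀ h₂ h₁ hr
  have hδ := norm_delta_le W x₀ h₁ h₂ hr
  have hq : ‖adjoint W (zN W x₀ N₁) - ba W x₀‖ ≤ 4 * r * ‖ba W x₀‖ := by
    rw [ba, ← map_sub]; exact hG₁
  have hΔ : ‖N₂ - N₁‖ ≤ 2 * r := (norm_sub_le _ _).trans (by linarith)
  have hδ2 : ‖zN W x₀ N₂ - zN W x₀ N₁‖ ^ 2 ≤ 32 * r * ‖ba W x₀‖ ^ 2 * ‖N₂ - N₁‖ := by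
    have h0 := norm_nonneg (zN W x₀ N₂ - zN W x₀ N₁)
    have h4 : ‖zN W x₀ N₂ - zN W x₀ N₁‖ ≤ 4 * ‖ba W x₀‖ * (2 * r) :=
      hδ.trans (by gcongr)
    nlinarith [mul_nonneg hA (norm_nonneg (N₂ - N₁)), mul_nonneg (mul_nonneg hA hA) (norm_nonneg (N₂ - N₁))]
  have key := norm_inner_bilin_sub_le (bπ W x₀ 0 0) (bπ W x₀ N₂ N₁)
    (ba W x₀) (adjoint W (zN W x₀ N₁)) (Lin (N₂ - N₁)) (Q N₂ - Q N₁)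
  have hre : |(⟪bπ W x₀ N₂ N₁, (Q N₂ - Q N₁) (adjoint W (zN W x₀ N₁))⟫_ℂ).re -
      (⟪bπ W x₀ 0 0, Lin (N₂ - N₁) (ba W x₀)⟫_ℂ).re| ≤ 192 * r * ‖ba W x₀‖ ^ 2 * ‖N₂ - N₁‖ := by
    rw [← Complex.sub_re]
    calc _ ≤ _ := Complex.abs_re_le_norm _
      _ ≤ _ := key
      _ ≤ 22 * r * ‖ba W x₀‖ * (3 * ‖N₂ - N₁‖) * (2 * ‖ba W x₀‖) +
          5 * ‖ba W x₀‖ * (2 * r * ‖N₂ - N₁‖) * (2 * ‖ba W x₀‖) +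
          5 * ‖ba W x₀‖ * (2 * ‖N₂ - N₁‖) * (4 * r * ‖ba W x₀‖) :=
        add_le_add_three
          (norm_mul3_le hπ₂ hΔQ hw₁)
          (norm_mul3_le hπ hQL hw₁)
          (norm_mul3_le hπ hL hq)
      _ = 192 * r * ‖ba W x₀‖ ^ 2 * ‖N₂ - N₁‖ := by ring
  rw [eth_two_point]
  have := abs_le.1 hre
  rw [abs_le]
  constructor <;> nlinarith [this.1, this.2, hδ2, norm_nonneg (zN W x₀ N₂ - zN W x₀ N₁)]

/-! ### E. Normalisation, the first-order operator `Λ`, and the Graves step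

The parameter space of admissible directions is an arbitrary real Banach space `P` mapped additively and
ℝ-homogeneously into `E →L[ℂ] E` by `ι` with `‖ι p‖ ≤ ‖p‖` (in the application: a closed real subspace of the
commutant `{S}'`, so that `W(1 + ι p)` again intertwines `S`). -/

omit [CompleteSpace E] [CompleteSpace H] in
/-- `|x/A²| ≤ k` from `|x| ≤ kA²` (also when `A = 0`). [folklore] -/
lemma abs_div_sq_le {x A k : ℝ} (hk : 0 ≤ k) (h : |x| ≤ k * A ^ 2) : |x / A ^ 2| ≤ k := by
  by_cases hA : A = 0
  · simp [hA, hk]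
  · rw [abs_div, abs_of_pos (by positivity : 0 < A ^ 2), div_le_iff₀ (by positivity)]
    exact h

omit [CompleteSpace E] [CompleteSpace H] in
/-- `‖w/m‖ ≤ k` from `‖w‖ ≤ km` (also when `m = 0`). [folklore] -/
lemma norm_div_ofReal_le {w : ℂ} {m k : ℝ} (hk : 0 ≤ k) (hm : 0 ≤ m) (h : ‖w‖ ≤ k * m) :
    ‖w / (m : ℂ)‖ ≤ k := by
  by_cases h0 : m = 0
  · simp [h0, hk]
  · rw [norm_div, Complex.norm_real, Real.norm_eq_abs, abs_of_pos (lt_of_le_of_ne hm (Ne.symm h0)),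
      div_le_iff₀ (lt_of_le_of_ne hm (Ne.symm h0))]
    exact h

/-- `Lin` is additive. [folklore] -/
lemma Lin_add (Δ₁ Δ₂ : E →L[ℂ] E) : Lin (Δ₁ + Δ₂) = Lin Δ₁ + Lin Δ₂ := by
  simp only [Lin, map_add]; abel

/-- `Lin` is real-homogeneous (the adjoint is conjugate-linear). [folklore] -/
lemma Lin_smul (t : ℝ) (Δ : E →L[ℂ] E) : Lin ((t : ℂ) • Δ) = (t : ℂ) • Lin Δ := by
  have h : adjoint ((t : ℂ) • Δ) = (t : ℂ) • adjoint Δ := by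
    rw [LinearIsometryEquiv.map_smulₛₗ adjoint]
    simp
  rw [Lin, Lin, h, smul_add]

section Graves

variable {P : Type*} [NormedAddCommGroup P] [NormedSpace ℝ P]
variable (W : E →L[ℂ] H) (x₀ c : H) (ι : P →+ (E →L[ℂ] E))

/-- The three step functionals of a direction `p` — drift `Re⟪x₀, z' − z⟫` ((45)), side condition `⟪c, z' − z⟫`
((46)), decrease `(εθ)' − (εθ)` ((b′)) — normalised by their natural scales `(εθ)`, `(εθ)^{1/2}‖c‖`, `(εθ)`.
[cite: Enflo2023, v2 (36)–(38), (45), (46), p.16–19] -/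
def Φ (p : P) : ℝ × ℂ × ℝ :=
  ((⟪x₀, zN W x₀ (ι p) - bz W x₀⟫_ℂ).re / ‖ba W x₀‖ ^ 2,
    ⟪c, zN W x₀ (ι p) - bz W x₀⟫_ℂ / ((‖ba W x₀‖ * ‖c‖ : ℝ) : ℂ),
    (eth x₀ (zN W x₀ (ι p)) - eth x₀ (bz W x₀)) / ‖ba W x₀‖ ^ 2)

/-- The first-order parts of the three functionals ((36)–(38) linearised in the direction `Δ`), same
normalisation. [cite: Enflo2023, v2 (36)–(38), p.16] -/
def Λf (Δ : E →L[ℂ] E) : ℝ × ℂ × ℝ :=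
  (-(⟪ba W x₀, Lin Δ (ba W x₀)⟫_ℂ).re / ‖ba W x₀‖ ^ 2,
    -⟪bκ W c, Lin Δ (ba W x₀)⟫_ℂ / ((‖ba W x₀‖ * ‖c‖ : ℝ) : ℂ),
    -(⟪bπ W x₀ 0 0, Lin Δ (ba W x₀)⟫_ℂ).re / ‖ba W x₀‖ ^ 2)

omit [NormedSpace ℝ P] in
/-- no step, no change. [folklore] -/
@[simp] lemma Φ_zero : Φ W x₀ c ι 0 = 0 := by
  simp [Φ]

/-- `Λf` is additive. [folklore] -/
lemma Λf_add (Δ₁ Δ₂ : E →L[ℂ] E) : Λf W x₀ c (Δ₁ + Δ₂) = Λf W x₀ c Δ₁ + Λf W x₀ c Δ₂ := by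
  simp only [Λf, Lin_add, add_apply, inner_add_right, Complex.add_re, Prod.mk_add_mk]
  refine Prod.ext ?_ (Prod.ext ?_ ?_) <;> simp only <;> ring

/-- `Λf` is real-homogeneous. [folklore] -/
lemma Λf_smul (t : ℝ) (Δ : E →L[ℂ] E) : Λf W x₀ c ((t : ℂ) • Δ) = t • Λf W x₀ c Δ := by
  simp only [Λf, Lin_smul, smul_apply, inner_smul_right, Complex.re_ofReal_mul, Prod.smul_mk, smul_eq_mul,
    Complex.real_smul]
  refine Prod.ext ?_ (Prod.ext ?_ ?_) <;> simp only <;> ring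

/-- `‖Λf(Δ)‖ ≤ 10‖Δ‖`. [folklore] -/
lemma norm_Λf_le (Δ : E →L[ℂ] E) : ‖Λf W x₀ c Δ‖ ≤ 10 * ‖Δ‖ := by
  have hA := norm_nonneg (ba W x₀)
  have hL := norm_Lin_le Δ
  have hLa : ‖Lin Δ (ba W x₀)‖ ≤ 2 * ‖Δ‖ * ‖ba W x₀‖ := (le_opNorm _ _).trans (by gcongr)
  have h1 : |(-(⟪ba W x₀, Lin Δ (ba W x₀)⟫_ℂ).re)| ≤ 2 * ‖Δ‖ * ‖ba W x₀‖ ^ 2 := by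
    rw [abs_neg]
    calc _ ≤ ‖⟪ba W x₀, Lin Δ (ba W x₀)⟫_ℂ‖ := Complex.abs_re_le_norm _
      _ ≤ ‖ba W x₀‖ * ‖Lin Δ (ba W x₀)‖ := norm_inner_le_norm _ _
      _ ≤ ‖ba W x₀‖ * (2 * ‖Δ‖ * ‖ba W x₀‖) := by gcongr
      _ = 2 * ‖Δ‖ * ‖ba W x₀‖ ^ 2 := by ring
  have h2 : ‖-⟪bκ W c, Lin Δ (ba W x₀)⟫_ℂ‖ ≤ ‖Δ‖ * (‖ba W x₀‖ * ‖c‖) := by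
    rw [norm_neg]
    calc _ ≤ ‖bκ W c‖ * ‖Lin Δ (ba W x₀)‖ := norm_inner_le_norm _ _
      _ ≤ 1 / 2 * ‖c‖ * (2 * ‖Δ‖ * ‖ba W x₀‖) :=
          mul_le_mul (norm_bκ_le W c) hLa (norm_nonneg _) (by positivity)
      _ = ‖Δ‖ * (‖ba W x₀‖ * ‖c‖) := by ring
  have h3 : |(-(⟪bπ W x₀ 0 0, Lin Δ (ba W x₀)⟫_ℂ).re)| ≤ 10 * ‖Δ‖ * ‖ba W x₀‖ ^ 2 := by
    rw [abs_neg]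
    calc _ ≤ ‖⟪bπ W x₀ 0 0, Lin Δ (ba W x₀)⟫_ℂ‖ := Complex.abs_re_le_norm _
      _ ≤ ‖bπ W x₀ 0 0‖ * ‖Lin Δ (ba W x₀)‖ := norm_inner_le_norm _ _
      _ ≤ 5 * ‖ba W x₀‖ * (2 * ‖Δ‖ * ‖ba W x₀‖) :=
          mul_le_mul (norm_bπ_zero_le W x₀) hLa (norm_nonneg _) (by positivity)
      _ = 10 * ‖Δ‖ * ‖ba W x₀‖ ^ 2 := by ring
  rw [Λf, Prod.norm_def, Prod.norm_def, Real.norm_eq_abs, Real.norm_eq_abs]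
  refine max_le ((abs_div_sq_le (by positivity) h1).trans (by linarith [norm_nonneg Δ])) (max_le ?_ ?_)
  · exact norm_div_ofReal_le (norm_nonneg Δ) (by positivity) h2 |>.trans (by linarith [norm_nonneg Δ])
  · exact abs_div_sq_le (by positivity) h3

variable {W x₀ c ι}

/-- `Λ`: the first-order parts as a continuous ℝ-linear operator on the parameter space (`‖Λ‖ ≤ 10`).
[cite: Enflo2023, v2 (36)–(38), p.16] -/
def Λ (hιs : ∀ (t : ℝ) (p : P), ι (t • p) = (t : ℂ) • ι p) (hι1 : ∀ p, ‖ι p‖ ≤ ‖p‖) :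
    P →L[ℝ] ℝ × ℂ × ℝ :=
  LinearMap.mkContinuous
    { toFun := fun p => Λf W x₀ c (ι p)
      map_add' := fun p q => by simp only [map_add, Λf_add]
      map_smul' := fun t p => by simp only [hιs, Λf_smul, RingHom.id_apply] }
    10 (fun p => (norm_Λf_le W x₀ c (ι p)).trans (by linarith [hι1 p]))

/-- `Λ p = Λf (ι p)`. [folklore] -/
@[simp] lemma Λ_apply (hιs : ∀ (t : ℝ) (p : P), ι (t • p) = (t : ℂ) • ι p) (hι1 : ∀ p, ‖ι p‖ ≤ ‖p‖)
    (p : P) : Λ (W := W) (x₀ := x₀) (c := c) hιs hι1 p = Λf W x₀ c (ι p) := rfl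

/-- THE REMAINDER ESTIMATE (what v2 p.16–17 uses without stating it): on the ball of radius `ρ ≤ 1/10` the
normalised step map is `250ρ`-approximately linear with derivative `Λ`, uniformly in `(εθ)` and `c`.
[cite: Enflo2023, v2 (36)–(38), p.16–17] -/
theorem approximatesLinearOn (hιs : ∀ (t : ℝ) (p : P), ι (t • p) = (t : ℂ) • ι p)
    (hι1 : ∀ p, ‖ι p‖ ≤ ‖p‖) {ρ : ℝ} (hρ0 : 0 ≤ ρ) (hρ : ρ ≤ 1 / 10) :
    ApproximatesLinearOn (Φ W x₀ c ι) (Λ (W := W) (x₀ := x₀) (c := c) hιs hι1) (closedBall 0 ρ)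
      (250 * ρ).toNNReal := by
  intro p hp q hq
  have h₂ : ‖ι p‖ ≤ ρ := (hι1 p).trans (mem_closedBall_zero_iff.1 hp)
  have h₁ : ‖ι q‖ ≤ ρ := (hι1 q).trans (mem_closedBall_zero_iff.1 hq)
  have hA := norm_nonneg (ba W x₀)
  have E1 := drift_remainder W x₀ h₁ h₂ hρ
  have E2 := side_remainder W x₀ c h₁ h₂ hρ
  have E3 := eth_remainder W x₀ h₁ h₂ hρ
  have hΔ : ‖ι p - ι q‖ ≤ ‖p - q‖ := by rw [← map_sub]; exact hι1 _
  have hm : 0 ≤ ρ * ‖p - q‖ := by positivity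
  have hval : Φ W x₀ c ι p - Φ W x₀ c ι q - Λ (W := W) (x₀ := x₀) (c := c) hιs hι1 (p - q) =
      (((⟪x₀, zN W x₀ (ι p) - zN W x₀ (ι q)⟫_ℂ).re + (⟪ba W x₀, Lin (ι p - ι q) (ba W x₀)⟫_ℂ).re) /
          ‖ba W x₀‖ ^ 2,
        (⟪c, zN W x₀ (ι p) - zN W x₀ (ι q)⟫_ℂ + ⟪bκ W c, Lin (ι p - ι q) (ba W x₀)⟫_ℂ) /
          ((‖ba W x₀‖ * ‖c‖ : ℝ) : ℂ),
        (eth x₀ (zN W x₀ (ι p)) - eth x₀ (zN W x₀ (ι q)) + (⟪bπ W x₀ 0 0, Lin (ι p - ι q) (ba W x₀)⟫_ℂ).re) /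
          ‖ba W x₀‖ ^ 2) := by
    rw [Λ_apply, map_sub]
    simp only [Φ, Λf, Prod.mk_sub_mk, inner_sub_right, Complex.sub_re]
    refine Prod.ext ?_ (Prod.ext ?_ ?_) <;> simp only <;> ring
  rw [hval, Prod.norm_def, Prod.norm_def, Real.norm_eq_abs, Real.norm_eq_abs,
    Real.coe_toNNReal _ (by positivity)]
  refine max_le ?_ (max_le ?_ ?_)
  · refine abs_div_sq_le (by positivity) (E1.trans ?_)
    calc 36 * ρ * ‖ba W x₀‖ ^ 2 * ‖ι p - ι q‖ ≤ 36 * ρ * ‖ba W x₀‖ ^ 2 * ‖p - q‖ := by gcongr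
      _ ≤ 250 * ρ * ‖p - q‖ * ‖ba W x₀‖ ^ 2 := by nlinarith [mul_nonneg hm (sq_nonneg ‖ba W x₀‖)]
  · refine norm_div_ofReal_le (by positivity) (by positivity) (E2.trans ?_)
    calc 18 * ρ * ‖c‖ * ‖ba W x₀‖ * ‖ι p - ι q‖ ≤ 18 * ρ * ‖c‖ * ‖ba W x₀‖ * ‖p - q‖ := by gcongr
      _ ≤ 250 * ρ * ‖p - q‖ * (‖ba W x₀‖ * ‖c‖) := by
          nlinarith [mul_nonneg hm (mul_nonneg hA (norm_nonneg c))]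
  · refine abs_div_sq_le (by positivity) (E3.trans ?_)
    calc 224 * ρ * ‖ba W x₀‖ ^ 2 * ‖ι p - ι q‖ ≤ 224 * ρ * ‖ba W x₀‖ ^ 2 * ‖p - q‖ := by gcongr
      _ ≤ 250 * ρ * ‖p - q‖ * ‖ba W x₀‖ ^ 2 := by nlinarith [mul_nonneg hm (sq_nonneg ‖ba W x₀‖)]

variable (W x₀ c ι)

/-- (34)–(38) IN THE FORM THE TEXT USES THEM (tex L547–L583, L643: "(36), (37) and (38) are of the same order of
magnitude … by forming linear combinations of the `y + r_j(T)y` we can … move `y′` in any direction"): the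
normalised first-order functionals are jointly surjective on the parameter space with constant `σ` — every
target triple `t` is the first-order effect of an admissible direction `p` with `‖p‖ ≤ ‖t‖/σ`.
THREE-FOLD form — CAUTION: with the natural side vector `c = x₀ − z` the three functionals are linearly
DEPENDENT and this never holds (`first_order_dependent`, `not_indepBr_self`, §G); the honest residual at step level is
the TWO-FOLD form `IndepBr₂` (targets: side condition and decrease; the drift is then bounded, `exists_step₂`).
[cite: Enflo2023, v2 (34)–(38), p.16–17] -/
def IndepBr (σ : ℝ) : Prop := ∀ t : ℝ × ℂ × ℝ, ∃ p : P, Λf W x₀ c (ι p) = t ∧ ‖p‖ ≤ ‖t‖ / σ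

/-- GRAVES STEP: under `IndepBr σ` every target triple of size `≤ σ²/1000` is realised EXACTLY (remainders
included) by a direction of size `≤ σ/500`. [cite: Enflo2023, v2 (36)–(40), p.16–17] -/
theorem exists_preimage [CompleteSpace P] (hιs : ∀ (t : ℝ) (p : P), ι (t • p) = (t : ℂ) • ι p)
    (hι1 : ∀ p, ‖ι p‖ ≤ ‖p‖) {σ : ℝ} (hσ : 0 < σ) (hσ1 : σ ≤ 1) (hind : IndepBr W x₀ c ι σ)
    (t : ℝ × ℂ × ℝ) (ht : ‖t‖ ≤ σ ^ 2 / 1000) :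
    ∃ p : P, ‖p‖ ≤ σ / 500 ∧ Φ W x₀ c ι p = t := by
  have hρ : σ / 500 ≤ 1 / 10 := by linarith
  have hρ0 : 0 ≤ σ / 500 := by positivity
  have hA := approximatesLinearOn (W := W) (x₀ := x₀) (c := c) hιs hι1 hρ0 hρ
  let RI : (Λ (W := W) (x₀ := x₀) (c := c) hιs hι1).NonlinearRightInverse :=
    { toFun := fun t => Classical.choose (hind t)
      nnnorm := (σ⁻¹).toNNReal
      bound' := fun t => by
        have := (Classical.choose_spec (hind t)).2
        rw [Real.coe_toNNReal _ (inv_nonneg.2 hσ.le), ← div_eq_inv_mul]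
        exact this
      right_inv' := fun t => by
        rw [Λ_apply]
        exact (Classical.choose_spec (hind t)).1 }
  have hs := hA.surjOn_closedBall_of_nonlinearRightInverse RI hρ0 subset_rfl
  have hrad : (((RI.nnnorm : ℝ))⁻¹ - ((250 * (σ / 500)).toNNReal : ℝ)) * (σ / 500) = σ ^ 2 / 1000 := by
    rw [show (RI.nnnorm : ℝ) = σ⁻¹ from Real.coe_toNNReal _ (inv_nonneg.2 hσ.le), inv_inv,
      Real.coe_toNNReal _ (by positivity)]
    ring
  rw [hrad, Φ_zero] at hs
  obtain ⟨p, hp, hpt⟩ := hs (mem_closedBall_zero_iff.2 ht)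
  exact ⟨p, mem_closedBall_zero_iff.1 hp, hpt⟩

/-- THE CONSTRAINED STEP WITH REMAINDERS (bracket level): under `IndepBr σ`, for `0 ≤ β ≤ σ²/1000` there is an
admissible direction `p`, `‖p‖ ≤ σ/500`, whose EXACT new MC vector `z' = [ ]⁻¹_{ι p} x₀` has
`(εθ)' = (1 − β)(εθ)` ((b′)), `⟪c, z' − z⟫ = 0` ((46)), `Re⟪x₀, z' − z⟫ = −β(εθ)` (so (45) with `C = 1`), and
`‖z'‖ = ‖z‖` (ε is kept). [cite: Enflo2023, v2 (39)–(46), p.17–19] -/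
theorem exists_step [CompleteSpace P] (hιs : ∀ (t : ℝ) (p : P), ι (t • p) = (t : ℂ) • ι p)
    (hι1 : ∀ p, ‖ι p‖ ≤ ‖p‖) {σ β : ℝ} (hσ : 0 < σ) (hσ1 : σ ≤ 1) (hβ0 : 0 ≤ β)
    (hβ : β ≤ σ ^ 2 / 1000) (hA : ba W x₀ ≠ 0) (hind : IndepBr W x₀ c ι σ) :
    ∃ p : P, ‖p‖ ≤ σ / 500 ∧
      eth x₀ (zN W x₀ (ι p)) = (1 - β) * eth x₀ (bz W x₀) ∧
      ⟪c, zN W x₀ (ι p) - bz W x₀⟫_ℂ = 0 ∧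
      (⟪x₀, zN W x₀ (ι p) - bz W x₀⟫_ℂ).re = -(β * eth x₀ (bz W x₀)) ∧
      ‖zN W x₀ (ι p)‖ = ‖bz W x₀‖ := by
  have ht : ‖((-β, 0, -β) : ℝ × ℂ × ℝ)‖ ≤ σ ^ 2 / 1000 := by
    simp only [Prod.norm_def, Real.norm_eq_abs, abs_neg, abs_of_nonneg hβ0, norm_zero]
    exact max_le hβ (max_le (hβ0.trans hβ) hβ)
  obtain ⟨p, hp, hΦ⟩ := exists_preimage W x₀ c ι hιs hι1 hσ hσ1 hind _ ht
  have hA0 : 0 < ‖ba W x₀‖ := norm_pos_iff.2 hA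
  have hA2 : (0 : ℝ) < ‖ba W x₀‖ ^ 2 := by positivity
  simp only [Φ, Prod.mk.injEq] at hΦ
  obtain ⟨h1, h2, h3⟩ := hΦ
  rw [div_eq_iff hA2.ne'] at h1 h3
  have he := eth_bz W x₀
  rw [he] at h3 ⊢
  refine ⟨p, hp, by linarith, ?_, by linarith, ?_⟩
  · rcases div_eq_zero_iff.1 h2 with h | h
    · exact h
    · have hc : ‖ba W x₀‖ * ‖c‖ = 0 := by exact_mod_cast h
      have : ‖c‖ = 0 := (mul_eq_zero.1 hc).resolve_left hA0.ne'
      rw [norm_eq_zero.1 this, inner_zero_left]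
  · have hz' := norm_sq_eq_of_isBracket (isBracket_zN W x₀ (ι p))
    have hz := norm_sq_eq_of_isBracket (isBracket_bz W x₀)
    have hdr : (⟪zN W x₀ (ι p), x₀⟫_ℂ).re - (⟪bz W x₀, x₀⟫_ℂ).re =
        (⟪x₀, zN W x₀ (ι p) - bz W x₀⟫_ℂ).re := by
      rw [← Complex.sub_re, ← inner_sub_left]
      have := inner_re_symm (𝕜 := ℂ) (zN W x₀ (ι p) - bz W x₀) x₀
      simpa only [RCLike.re_to_complex] using this
    have hsq : ‖zN W x₀ (ι p)‖ ^ 2 = ‖bz W x₀‖ ^ 2 := by rw [hz', hz]; linarith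
    exact (sq_eq_sq₀ (norm_nonneg _) (norm_nonneg _)).1 hsq

/-! #### G. The faithful form of (34): side condition and decrease TARGETED, the drift only BOUNDED

With the natural side-condition vector `c = x₀ − z` (the moved vector itself: angle `0` in (40)) the three
first-order functionals are LINEARLY DEPENDENT (`first_order_dependent`: decrease `= 2·Re(side) − drift` up to the
normalisations), so the three-fold independence `IndepBr` NEVER holds there (`not_indepBr_self`) — asked along a run,
where every pivot step has exactly this `c`, it would be vacuous.  What the text uses is independence of the TWO
TARGETED functionals, side condition (46) and decrease (b′) — in the commutant-of-the-shift picture (`Δ =`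
multiplication by `r(e^{iθ})`, `L_Δ ↔ 2 Re r`) this is the `(εθ)`-linear independence (34) of `f f̄` and `f ḡ` of
(28″)–(29″) with `f ↔ ℓ = W†z` ((35)) and `g ↔ W†[ ]⁻¹z` ((36)) — while the drift (45) is a CONSEQUENCE of the
smallness of the step ("from (39) … we now conclude (45)", v2 p.19): here `|Re⟪x₀, z' − z⟫| ≤ 11‖p‖(εθ) ≤ (22/σ)β(εθ)`,
and the radius then moves by `|‖z'‖² − ‖z‖²| ≤ (22/σ + 1)β(εθ)` per step (summable along the run: `Σ β(εθ)_n ≤ (εθ)₀`). -/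

/-- DEPENDENCE AT THE PIVOT: with `c = x₀ − z` the decrease functional is `2·Re(side) − drift`:
`Re⟪π₀, L_Δ ℓ⟫ = 2 Re⟪κ_{x₀−z}, L_Δ ℓ⟫ − Re⟪ℓ, L_Δ ℓ⟫` (`π₀ = ℓ − 2W†[ ]⁻¹z`, `κ_{x₀−z} = ℓ − W†[ ]⁻¹z`). [folklore] -/
theorem first_order_dependent (Δ : E →L[ℂ] E) :
    (⟪bπ W x₀ 0 0, Lin Δ (ba W x₀)⟫_ℂ).re =
      2 * (⟪bκ W (x₀ - bz W x₀), Lin Δ (ba W x₀)⟫_ℂ).re - (⟪ba W x₀, Lin Δ (ba W x₀)⟫_ℂ).re := by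
  have hπ : bπ W x₀ 0 0 =
      ba W x₀ - (adjoint W (brInv W (bz W x₀)) + adjoint W (brInv W (bz W x₀))) := by
    rw [← two_smul ℂ (adjoint W (brInv W (bz W x₀)))]
    simp only [bπ, perturb_zero, zN_zero, map_sub, map_smul]
    rfl
  have hκ : bκ W (x₀ - bz W x₀) = ba W x₀ - adjoint W (brInv W (bz W x₀)) := by
    simp only [bκ, map_sub]
    rfl
  rw [hπ, hκ, inner_sub_left, inner_sub_left, inner_add_left, Complex.sub_re, Complex.sub_re, Complex.add_re]
  ring

omit [NormedSpace ℝ P] in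
/-- Hence the THREE-fold independence fails whenever the side-condition vector is the moved vector `x₀ − z` itself
(every `W`, every `σ`): the target `(1, 0, 0)` — move the drift alone — has no first-order preimage. [folklore] -/
theorem not_indepBr_self (σ : ℝ) : ¬ IndepBr W x₀ (x₀ - bz W x₀) ι σ := by
  intro h
  obtain ⟨p, hp, -⟩ := h (1, 0, 0)
  have hd := first_order_dependent W x₀ (ι p)
  simp only [Λf, Prod.mk.injEq] at hp
  obtain ⟨h1, h2, h3⟩ := hp
  by_cases hA : ba W x₀ = 0
  · simp [hA] at h1
  · have hA0 : 0 < ‖ba W x₀‖ := norm_pos_iff.2 hA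
    have hA2 : (0 : ℝ) < ‖ba W x₀‖ ^ 2 := by positivity
    have e1 : -(⟪ba W x₀, Lin (ι p) (ba W x₀)⟫_ℂ).re = ‖ba W x₀‖ ^ 2 := by
      rwa [div_eq_iff hA2.ne', one_mul] at h1
    have e3 : -(⟪bπ W x₀ 0 0, Lin (ι p) (ba W x₀)⟫_ℂ).re = 0 := by
      rcases div_eq_zero_iff.1 h3 with h | h
      · exact h
      · exact absurd h hA2.ne'
    have e2 : (⟪bκ W (x₀ - bz W x₀), Lin (ι p) (ba W x₀)⟫_ℂ).re = 0 := by
      rcases div_eq_zero_iff.1 h2 with h | h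
      · rw [neg_eq_zero] at h
        rw [h, Complex.zero_re]
      · have hc : ‖ba W x₀‖ * ‖x₀ - bz W x₀‖ = 0 := by exact_mod_cast h
        have h0 : x₀ - bz W x₀ = 0 := norm_eq_zero.1 ((mul_eq_zero.1 hc).resolve_left hA0.ne')
        rw [h0]
        simp [bκ]
    linarith

/-- THE TWO TARGETED FUNCTIONALS — side condition (46) and decrease (b′), normalised — are `σ`-INDEPENDENT: every
target pair `t` is the first-order effect of an admissible direction `p` with `‖p‖ ≤ ‖t‖/σ`.  In the
commutant-of-the-shift picture: the `(εθ)`-linear independence (34) of `f f̄` and `f ḡ` ((28″)–(29″), (35)–(36)),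
quantified.  THE HONEST RESIDUAL AT STEP LEVEL (the drift (45) is then a consequence, `exists_step₂`).
[cite: Enflo2023, v2 (34)–(38), p.16–17] -/
def IndepBr₂ (σ : ℝ) : Prop := ∀ t : ℂ × ℝ, ∃ p : P, (Λf W x₀ c (ι p)).2 = t ∧ ‖p‖ ≤ ‖t‖ / σ

variable {W x₀ c ι}

/-- the two targeted first-order functionals as a continuous ℝ-linear operator (`snd ∘ Λ`). [folklore] -/
def Λ₂ (hιs : ∀ (t : ℝ) (p : P), ι (t • p) = (t : ℂ) • ι p) (hι1 : ∀ p, ‖ι p‖ ≤ ‖p‖) :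
    P →L[ℝ] ℂ × ℝ :=
  (ContinuousLinearMap.snd ℝ ℝ (ℂ × ℝ)).comp (Λ (W := W) (x₀ := x₀) (c := c) hιs hι1)

/-- `Λ₂ p = (Λf (ι p)).2`. [folklore] -/
@[simp] lemma Λ₂_apply (hιs : ∀ (t : ℝ) (p : P), ι (t • p) = (t : ℂ) • ι p) (hι1 : ∀ p, ‖ι p‖ ≤ ‖p‖)
    (p : P) : Λ₂ (W := W) (x₀ := x₀) (c := c) hιs hι1 p = (Λf W x₀ c (ι p)).2 := rfl

/-- the remainder estimate for the targeted pair (a projection of `approximatesLinearOn`). [cite: Enflo2023, v2 (36)–(38), p.16–17] -/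
theorem approximatesLinearOn₂ (hιs : ∀ (t : ℝ) (p : P), ι (t • p) = (t : ℂ) • ι p)
    (hι1 : ∀ p, ‖ι p‖ ≤ ‖p‖) {ρ : ℝ} (hρ0 : 0 ≤ ρ) (hρ : ρ ≤ 1 / 10) :
    ApproximatesLinearOn (fun p => (Φ W x₀ c ι p).2) (Λ₂ (W := W) (x₀ := x₀) (c := c) hιs hι1) (closedBall 0 ρ)
      (250 * ρ).toNNReal := by
  intro p hp q hq
  have h := approximatesLinearOn (W := W) (x₀ := x₀) (c := c) hιs hι1 hρ0 hρ p hp q hq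
  have heq : (Φ W x₀ c ι p).2 - (Φ W x₀ c ι q).2 - Λ₂ (W := W) (x₀ := x₀) (c := c) hιs hι1 (p - q) =
      (Φ W x₀ c ι p - Φ W x₀ c ι q - Λ (W := W) (x₀ := x₀) (c := c) hιs hι1 (p - q)).2 := by
    simp only [Prod.snd_sub, Λ₂_apply, Λ_apply]
  show ‖(Φ W x₀ c ι p).2 - (Φ W x₀ c ι q).2 - Λ₂ (W := W) (x₀ := x₀) (c := c) hιs hι1 (p - q)‖ ≤ _
  rw [heq]
  exact (_root_.norm_snd_le _).trans h

variable (W x₀ c ι)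

/-- GRAVES STEP FOR THE TARGETED PAIR: under `IndepBr₂ σ` every target pair `t` of size `≤ σ²/1000` is realised
EXACTLY (remainders included) by a direction of size `≤ 2‖t‖/σ` — linear in the target, which is what bounds the
drift. [cite: Enflo2023, v2 (36)–(40), p.16–17] -/
theorem exists_preimage₂ [CompleteSpace P] (hιs : ∀ (t : ℝ) (p : P), ι (t • p) = (t : ℂ) • ι p)
    (hι1 : ∀ p, ‖ι p‖ ≤ ‖p‖) {σ : ℝ} (hσ : 0 < σ) (hσ1 : σ ≤ 1) (hind : IndepBr₂ W x₀ c ι σ)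
    (t : ℂ × ℝ) (ht : ‖t‖ ≤ σ ^ 2 / 1000) :
    ∃ p : P, ‖p‖ ≤ 2 * ‖t‖ / σ ∧ (Φ W x₀ c ι p).2 = t := by
  have ht0 := norm_nonneg t
  have hσ2 : σ ^ 2 ≤ σ := by nlinarith
  have hρ0 : 0 ≤ 2 * ‖t‖ / σ := by positivity
  have hρ : 2 * ‖t‖ / σ ≤ 1 / 10 := by
    rw [div_le_iff₀ hσ]; linarith
  have hA := approximatesLinearOn₂ (W := W) (x₀ := x₀) (c := c) hιs hι1 hρ0 hρ
  let RI : (Λ₂ (W := W) (x₀ := x₀) (c := c) hιs hι1).NonlinearRightInverse :=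
    { toFun := fun t => Classical.choose (hind t)
      nnnorm := (σ⁻¹).toNNReal
      bound' := fun t => by
        have := (Classical.choose_spec (hind t)).2
        rw [Real.coe_toNNReal _ (inv_nonneg.2 hσ.le), ← div_eq_inv_mul]
        exact this
      right_inv' := fun t => by
        rw [Λ₂_apply]
        exact (Classical.choose_spec (hind t)).1 }
  have hs := hA.surjOn_closedBall_of_nonlinearRightInverse RI hρ0 subset_rfl
  have hrad : ‖t‖ ≤ (((RI.nnnorm : ℝ))⁻¹ - ((250 * (2 * ‖t‖ / σ)).toNNReal : ℝ)) * (2 * ‖t‖ / σ) := by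
    rw [show (RI.nnnorm : ℝ) = σ⁻¹ from Real.coe_toNNReal _ (inv_nonneg.2 hσ.le), inv_inv,
      Real.coe_toNNReal _ (by positivity)]
    have h1 : 250 * (2 * ‖t‖ / σ) ≤ σ / 2 := by
      rw [show 250 * (2 * ‖t‖ / σ) = 500 * ‖t‖ / σ by ring, div_le_iff₀ hσ]
      nlinarith
    have h2 : (σ / 2) * (2 * ‖t‖ / σ) ≤ (σ - 250 * (2 * ‖t‖ / σ)) * (2 * ‖t‖ / σ) :=
      mul_le_mul_of_nonneg_right (by linarith) hρ0
    have h3 : (σ / 2) * (2 * ‖t‖ / σ) = ‖t‖ := by field_simp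
    linarith
  have hmem : t ∈ closedBall ((fun p => (Φ W x₀ c ι p).2) 0)
      ((((RI.nnnorm : ℝ))⁻¹ - ((250 * (2 * ‖t‖ / σ)).toNNReal : ℝ)) * (2 * ‖t‖ / σ)) := by
    simpa only [mem_closedBall, dist_eq_norm, Φ_zero, Prod.snd_zero, sub_zero] using hrad
  obtain ⟨p, hp, hpt⟩ := hs hmem
  exact ⟨p, mem_closedBall_zero_iff.1 hp, hpt⟩

/-- THE CONSTRAINED STEP WITH REMAINDERS, FAITHFUL FORM (bracket level): under `IndepBr₂ σ`, for `0 ≤ β ≤ σ²/1000`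
there is an admissible direction `p`, `‖p‖ ≤ 2β/σ`, whose EXACT new MC vector `z' = [ ]⁻¹_{ι p} x₀` has
`(εθ)' = (1 − β)(εθ)` ((b′)) and `⟪c, z' − z⟫ = 0` ((46)) EXACTLY, the drift bound (45) in the form
`|Re⟪x₀, z' − z⟫| ≤ (22/σ)β(εθ)`, and `|‖z'‖² − ‖z‖²| ≤ (22/σ + 1)β(εθ)`. [cite: Enflo2023, v2 (39)–(46), p.17–19] -/
theorem exists_step₂ [CompleteSpace P] (hιs : ∀ (t : ℝ) (p : P), ι (t • p) = (t : ℂ) • ι p)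
    (hι1 : ∀ p, ‖ι p‖ ≤ ‖p‖) {σ β : ℝ} (hσ : 0 < σ) (hσ1 : σ ≤ 1) (hβ0 : 0 ≤ β)
    (hβ : β ≤ σ ^ 2 / 1000) (hA : ba W x₀ ≠ 0) (hind : IndepBr₂ W x₀ c ι σ) :
    ∃ p : P, ‖p‖ ≤ 2 * β / σ ∧
      eth x₀ (zN W x₀ (ι p)) = (1 - β) * eth x₀ (bz W x₀) ∧
      ⟪c, zN W x₀ (ι p) - bz W x₀⟫_ℂ = 0 ∧
      |(⟪x₀, zN W x₀ (ι p) - bz W x₀⟫_ℂ).re| ≤ 22 / σ * β * eth x₀ (bz W x₀) ∧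
      |‖zN W x₀ (ι p)‖ ^ 2 - ‖bz W x₀‖ ^ 2| ≤ (22 / σ + 1) * β * eth x₀ (bz W x₀) := by
  have hσ2 : σ ^ 2 ≤ σ := by nlinarith
  have ht : ‖((0, -β) : ℂ × ℝ)‖ = β := by
    simp only [Prod.norm_def, norm_zero, Real.norm_eq_abs, abs_neg, abs_of_nonneg hβ0]
    exact max_eq_right hβ0
  obtain ⟨p, hp, hΦ⟩ := exists_preimage₂ W x₀ c ι hιs hι1 hσ hσ1 hind (0, -β) (by rw [ht]; exact hβ)
  rw [ht] at hp
  have hA0 : 0 < ‖ba W x₀‖ := norm_pos_iff.2 hA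
  have hA2 : (0 : ℝ) < ‖ba W x₀‖ ^ 2 := by positivity
  -- the drift is bounded by smallness: ‖Φ p‖ ≤ ‖Φ p − Λ p‖ + ‖Λ p‖ ≤ (250ρ + 10)‖p‖ ≤ 11‖p‖
  have hρ0 : 0 ≤ 2 * β / σ := by positivity
  have hρ : 2 * β / σ ≤ 1 / 10 := by
    rw [div_le_iff₀ hσ]; linarith
  have hsmall : 250 * (2 * β / σ) ≤ 1 := by
    rw [show 250 * (2 * β / σ) = 500 * β / σ by ring, div_le_iff₀ hσ]; linarith
  have happ := approximatesLinearOn (W := W) (x₀ := x₀) (c := c) hιs hι1 hρ0 hρ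
    p (mem_closedBall_zero_iff.2 hp) 0 (mem_closedBall_zero_iff.2 (by rw [norm_zero]; exact hρ0))
  rw [Φ_zero, sub_zero, sub_zero, Real.coe_toNNReal _ (by positivity)] at happ
  have hΛ : ‖Λ (W := W) (x₀ := x₀) (c := c) hιs hι1 p‖ ≤ 10 * ‖p‖ := by
    rw [Λ_apply]; exact (norm_Λf_le W x₀ c (ι p)).trans (by linarith [hι1 p])
  have hΦn : ‖Φ W x₀ c ι p‖ ≤ 11 * ‖p‖ := by
    have hp0 := norm_nonneg p
    calc ‖Φ W x₀ c ι p‖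
        = ‖(Φ W x₀ c ι p - Λ (W := W) (x₀ := x₀) (c := c) hιs hι1 p) +
            Λ (W := W) (x₀ := x₀) (c := c) hιs hι1 p‖ := by rw [sub_add_cancel]
      _ ≤ ‖Φ W x₀ c ι p - Λ (W := W) (x₀ := x₀) (c := c) hιs hι1 p‖ +
            ‖Λ (W := W) (x₀ := x₀) (c := c) hιs hι1 p‖ := norm_add_le _ _
      _ ≤ 250 * (2 * β / σ) * ‖p‖ + 10 * ‖p‖ := add_le_add happ hΛ
      _ ≤ 11 * ‖p‖ := by nlinarith
  have hdrift : |(⟪x₀, zN W x₀ (ι p) - bz W x₀⟫_ℂ).re| ≤ 22 / σ * β * ‖ba W x₀‖ ^ 2 := by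
    have h1 : |(Φ W x₀ c ι p).1| ≤ 11 * ‖p‖ := by
      have := _root_.norm_fst_le (Φ W x₀ c ι p)
      rw [Real.norm_eq_abs] at this
      exact this.trans hΦn
    have h1' : |(⟪x₀, zN W x₀ (ι p) - bz W x₀⟫_ℂ).re / ‖ba W x₀‖ ^ 2| ≤ 11 * ‖p‖ := by
      simpa only [Φ] using h1
    rw [abs_div, abs_of_pos hA2, div_le_iff₀ hA2] at h1'
    calc _ ≤ 11 * ‖p‖ * ‖ba W x₀‖ ^ 2 := h1'
      _ ≤ 11 * (2 * β / σ) * ‖ba W x₀‖ ^ 2 := by gcongr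
      _ = 22 / σ * β * ‖ba W x₀‖ ^ 2 := by ring
  simp only [Φ, Prod.mk.injEq] at hΦ
  obtain ⟨h2, h3⟩ := hΦ
  rw [div_eq_iff hA2.ne'] at h3
  have he := eth_bz W x₀
  rw [he] at h3 ⊢
  have hside : ⟪c, zN W x₀ (ι p) - bz W x₀⟫_ℂ = 0 := by
    rcases div_eq_zero_iff.1 h2 with h | h
    · exact h
    · have hc : ‖ba W x₀‖ * ‖c‖ = 0 := by exact_mod_cast h
      have : ‖c‖ = 0 := (mul_eq_zero.1 hc).resolve_left hA0.ne'
      rw [norm_eq_zero.1 this, inner_zero_left]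
  have hz' := norm_sq_eq_of_isBracket (isBracket_zN W x₀ (ι p))
  have hz := norm_sq_eq_of_isBracket (isBracket_bz W x₀)
  rw [he] at hz
  have hdr : (⟪zN W x₀ (ι p), x₀⟫_ℂ).re - (⟪bz W x₀, x₀⟫_ℂ).re =
      (⟪x₀, zN W x₀ (ι p) - bz W x₀⟫_ℂ).re := by
    rw [← Complex.sub_re, ← inner_sub_left]
    have := inner_re_symm (𝕜 := ℂ) (zN W x₀ (ι p) - bz W x₀) x₀
    simpa only [RCLike.re_to_complex] using this
  have hrad : ‖zN W x₀ (ι p)‖ ^ 2 - ‖bz W x₀‖ ^ 2 =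
      (⟪x₀, zN W x₀ (ι p) - bz W x₀⟫_ℂ).re + β * ‖ba W x₀‖ ^ 2 := by
    rw [hz', hz, ← hdr]; linarith
  refine ⟨p, hp, by linarith, hside, hdrift, ?_⟩
  rw [hrad]
  calc |(⟪x₀, zN W x₀ (ι p) - bz W x₀⟫_ℂ).re + β * ‖ba W x₀‖ ^ 2|
      ≤ |(⟪x₀, zN W x₀ (ι p) - bz W x₀⟫_ℂ).re| + |β * ‖ba W x₀‖ ^ 2| := abs_add_le _ _
    _ ≤ 22 / σ * β * ‖ba W x₀‖ ^ 2 + β * ‖ba W x₀‖ ^ 2 := by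
        rw [abs_of_nonneg (by positivity : 0 ≤ β * ‖ba W x₀‖ ^ 2)]; exact add_le_add hdrift le_rfl
    _ = (22 / σ + 1) * β * ‖ba W x₀‖ ^ 2 := by ring


end Graves

end Estimates

/-! ### F. The admissible directions (the commutant of `S`) and the step at the level of MC states -/

section Commutant

variable (S : E →L[ℂ] E)

omit [CompleteSpace E] in
/-- real scalars act on `E →L[ℂ] E` through `ℝ ⊆ ℂ`. [folklore] -/
lemma real_smul_eq (t : ℝ) (N : E →L[ℂ] E) : t • N = (t : ℂ) • N := by
  ext x
  exact (Complex.coe_smul t (N x)).symm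

/-- The commutant `{S}'` of the coefficient contraction as a real normed space: the space of ADMISSIBLE step
directions `N` (`W → W(1+N)` keeps `V ∘ S = T ∘ V`; the text's `y → y + r(T)y`, `r` a polynomial, is the case
`N =` multiplication by `r` on `ℓ²`). [cite: Enflo2023, v2 p.16 ("`T^j(y' + r(T)y')`")] -/
def Comm : Submodule ℝ (E →L[ℂ] E) where
  carrier := {N | N ∘L S = S ∘L N}
  add_mem' {a b} ha hb := by
    simp only [Set.mem_setOf_eq] at ha hb ⊢
    rw [add_comp, comp_add, ha, hb]
  zero_mem' := by simp
  smul_mem' t {a} ha := by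
    simp only [Set.mem_setOf_eq] at ha ⊢
    rw [real_smul_eq, smul_comp, comp_smul, ha]

omit [CompleteSpace E] in
/-- membership in the commutant. [folklore] -/
lemma mem_comm {N : E →L[ℂ] E} : N ∈ Comm S ↔ N ∘L S = S ∘L N := Iff.rfl

/-- The commutant is closed. [folklore] -/
lemma isClosed_comm : IsClosed ((Comm S : Set (E →L[ℂ] E))) := by
  have hc : Continuous fun N : E →L[ℂ] E => N ∘L S - S ∘L N := by
    have h1 := ((ContinuousLinearMap.compL ℂ E E E).flip S).continuous
    have h2 := ((ContinuousLinearMap.compL ℂ E E E) S).continuous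
    have hfun : (fun N : E →L[ℂ] E => N ∘L S - S ∘L N) =
        fun N => ((ContinuousLinearMap.compL ℂ E E E).flip S) N - ((ContinuousLinearMap.compL ℂ E E E) S) N := by
      funext N
      simp
    rw [hfun]
    exact h1.sub h2
  have hset : (Comm S : Set (E →L[ℂ] E)) = (fun N : E →L[ℂ] E => N ∘L S - S ∘L N) ⁻¹' {0} := by
    ext N
    simp [mem_comm, sub_eq_zero]
  rw [hset]
  exact isClosed_singleton.preimage hc

/-- … hence complete. [folklore] -/
instance completeSpace_comm : CompleteSpace (Comm S) := (isClosed_comm S).completeSpace_coe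

/-- the inclusion of the commutant. [folklore] -/
def ιS : Comm S →+ (E →L[ℂ] E) := (Comm S).subtype.toAddMonoidHom

omit [CompleteSpace E] in
/-- `ιS p = p`. [folklore] -/
@[simp] lemma ιS_apply (p : Comm S) : ιS S p = (p : E →L[ℂ] E) := rfl

omit [CompleteSpace E] in
/-- the inclusion is isometric, real-homogeneous and lands in the commutant. [folklore] -/
lemma ιS_props :
    (∀ (t : ℝ) (p : Comm S), ιS S (t • p) = (t : ℂ) • ιS S p) ∧ (∀ p : Comm S, ‖ιS S p‖ ≤ ‖p‖) ∧
      ∀ p : Comm S, ιS S p ∘L S = S ∘L ιS S p := by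
  refine ⟨fun t p => ?_, fun p => le_rfl, fun p => p.2⟩
  rw [ιS_apply, ιS_apply, Submodule.coe_smul, real_smul_eq]

end Commutant

section StateLevel

open MCStep

variable {T : H →L[ℂ] H} {x₀ : H} {S : E →L[ℂ] E}

/-- The NORMALISED coefficient operator of a state, `W := C^{1/2}V` (v2 p.5: `y = C^{1/2}y'`), `1/C = C' =
(εθ)/‖ℓ'‖²` by (6); its bracket point is the state's MC vector (`isBracket_Wn`). [cite: Enflo2023, v2 (5)–(6), (13)–(15), p.3–6] -/
def Wn (s : State T x₀ S) : E →L[ℂ] H := ((Real.sqrt (‖s.a‖ ^ 2 / s.etheta) : ℝ) : ℂ) • s.V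

/-- (5)/(6) with the multiplier identified: `V†(x₀ − Vℓ') = ((εθ)/‖ℓ'‖²)·ℓ'`. [cite: Enflo2023, v2 (5)–(6), p.3–4] -/
lemma kkt_etheta (hx₀ : ‖x₀‖ = 1) (s : State T x₀ S) :
    adjoint s.V (x₀ - s.V s.a) = ((s.etheta / ‖s.a‖ ^ 2 : ℝ) : ℂ) • s.a := by
  have hne : s.a ≠ 0 := s.hmin.ne_zero (s.eps_lt hx₀)
  obtain ⟨C', -, hC'⟩ := s.hmin.kkt hne
  have hE : s.etheta = C' * ‖s.a‖ ^ 2 := by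
    show (⟪x₀ - s.V s.a, s.V s.a⟫_ℂ).re = _
    rw [IsMinimal.eq6 hC', Complex.ofReal_re]
  have ha : (0 : ℝ) < ‖s.a‖ ^ 2 := by positivity
  rw [hC', hE, mul_div_assoc, div_self ha.ne', mul_one]

/-- The state's MC vector is the bracket point of its normalised operator (when `(εθ) > 0`). [cite: Enflo2023, v2 (13)–(15), p.6] -/
lemma isBracket_Wn (hx₀ : ‖x₀‖ = 1) (s : State T x₀ S) (he : 0 < s.etheta) : IsBracket (Wn s) x₀ s.v := by
  have hne : s.a ≠ 0 := s.hmin.ne_zero (s.eps_lt hx₀)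
  have hC : 0 < s.etheta / ‖s.a‖ ^ 2 := div_pos he (by positivity)
  have h := (isBracket_of_kkt hC (kkt_etheta hx₀ s)).1
  rw [one_div_div] at h
  exact h

omit [CompleteSpace E] [CompleteSpace H] in
/-- `(εθ)` of a state is `eth` of its MC vector. [cite: Enflo2023, v2 (16), p.6] -/
lemma etheta_eq_eth (s : State T x₀ S) : s.etheta = eth x₀ s.v := by
  show (⟪x₀ - s.V s.a, s.V s.a⟫_ℂ).re = (⟪s.v, x₀ - s.v⟫_ℂ).re
  rw [s.sub_v]
  rfl

variable {P : Type*} [NormedAddCommGroup P] [NormedSpace ℝ P]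

/-- THE STATE-LEVEL HYPOTHESIS ((34)–(38) at the state `s` for the side-condition vector `c`): first-order
independence `IndepBr` of the three step functionals of the state's normalised bracket model, with constant `σ`,
over the direction space `ι : P → (E →L[ℂ] E)` (three-fold form; VACUOUS for `c = x₀ − v`, see `not_indepBr_self` —
the faithful form is `IndepAt₂`). [cite: Enflo2023, v2 (34)–(38), p.16–17] -/
def IndepAt (ι : P →+ (E →L[ℂ] E)) (σ : ℝ) (s : State T x₀ S) (c : H) : Prop := IndepBr (Wn s) x₀ c ι σ

/-- THE MC STEP REALISED, WITH REMAINDERS: at a true MC state `s` with `(εθ) > 0` where the first-order functionals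
are `σ`-independent over admissible directions commuting with `S`, for every `0 ≤ β ≤ σ²/1000` there is a TRUE MC
state `s'` (same radius `ε`, coefficient operator `W(1 + ι p)` with `‖p‖ ≤ σ/500`) with EXACTLY
`(εθ)' = (1−β)(εθ)` ((b′)), `⟪c, v' − v⟫ = 0` ((46)) and `Re⟪x₀, v' − v⟫ = −β(εθ)` ((45) with `C = 1`).
[cite: Enflo2023, v2 (34)–(46), p.16–19] -/
theorem exists_state_step [CompleteSpace P] {ι : P →+ (E →L[ℂ] E)}
    (hιs : ∀ (t : ℝ) (p : P), ι (t • p) = (t : ℂ) • ι p) (hι1 : ∀ p, ‖ι p‖ ≤ ‖p‖)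
    (hιS : ∀ p, ι p ∘L S = S ∘L ι p) (hx₀ : ‖x₀‖ = 1) (s : State T x₀ S) (he : 0 < s.etheta)
    {σ β : ℝ} (hσ : 0 < σ) (hσ1 : σ ≤ 1) (hβ0 : 0 ≤ β) (hβ : β ≤ σ ^ 2 / 1000) (c : H)
    (hind : IndepAt ι σ s c) :
    ∃ s' : State T x₀ S, s'.etheta = (1 - β) * s.etheta ∧ ⟪c, s'.v - s.v⟫_ℂ = 0 ∧
      (⟪x₀, s'.v - s.v⟫_ℂ).re = -(β * s.etheta) ∧ s'.ε = s.ε ∧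
      ∃ p : P, ‖p‖ ≤ σ / 500 ∧ s'.V = Wn s ∘L (1 + ι p) := by
  have hbr : IsBracket (Wn s) x₀ s.v := isBracket_Wn hx₀ s he
  have hvz : s.v = bz (Wn s) x₀ := hbr.unique (isBracket_bz (Wn s) x₀)
  have hes : s.etheta = eth x₀ (bz (Wn s) x₀) := by rw [etheta_eq_eth, hvz]
  have hA : ba (Wn s) x₀ ≠ 0 := by
    intro h0
    have : eth x₀ (bz (Wn s) x₀) = 0 := by rw [eth_bz, h0, norm_zero]; ring
    linarith
  obtain ⟨p, hp, h1, h2, h3, h4⟩ := exists_step (Wn s) x₀ c ι hιs hι1 hσ hσ1 hβ0 hβ hA hind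
  have hbr' : IsBracket (Wn s ∘L (1 + ι p)) x₀ (zN (Wn s) x₀ (ι p)) := isBracket_zN (Wn s) x₀ (ι p)
  have hVS' : ∀ b, (Wn s ∘L (1 + ι p)) (S b) = T ((Wn s ∘L (1 + ι p)) b) := by
    intro b
    have hNS : ι p (S b) = S (ι p b) := by
      have := congrArg (fun A : E →L[ℂ] E => A b) (hιS p)
      simpa using this
    have h1' : (1 + ι p) (S b) = S ((1 + ι p) b) := by
      simp [hNS, map_add]
    rw [comp_apply, comp_apply, h1', Wn, smul_apply, smul_apply, s.hVS, map_smul]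
  have hn : ‖zN (Wn s) x₀ (ι p)‖ = s.ε := by rw [h4, ← hvz, s.norm_v hx₀]
  have hmin' : IsMinimal (Wn s ∘L (1 + ι p)) x₀ s.ε (adjoint (Wn s ∘L (1 + ι p)) (zN (Wn s) x₀ (ι p))) := by
    rw [← hn]; exact hbr'.isMinimal
  let s' : State T x₀ S := ⟨Wn s ∘L (1 + ι p), hVS', s.ε, s.hε, _, hmin'⟩
  have hv' : s'.v = zN (Wn s) x₀ (ι p) := hbr'.sub_eq
  have he' : s'.etheta = eth x₀ (zN (Wn s) x₀ (ι p)) := by rw [etheta_eq_eth, hv']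
  refine ⟨s', ?_, ?_, ?_, rfl, p, hp, rfl⟩
  · rw [he', hes, h1]
  · rw [hv', hvz, h2]
  · rw [hv', hvz, h3, ← hes]

/-- THE STATE-LEVEL HYPOTHESIS, faithful form: `σ`-independence of the TWO targeted functionals (side condition,
decrease) of the state's normalised bracket model, over the direction space `ι`. [cite: Enflo2023, v2 (34), (36)–(38), p.16–17] -/
def IndepAt₂ (ι : P →+ (E →L[ℂ] E)) (σ : ℝ) (s : State T x₀ S) (c : H) : Prop := IndepBr₂ (Wn s) x₀ c ι σ

/-- THE MC STEP REALISED, WITH REMAINDERS — FAITHFUL FORM: at a true MC state `s` with `(εθ) > 0` where the two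
targeted functionals are `σ`-independent over admissible directions commuting with `S`, for `0 ≤ β ≤ σ²/1000`, and
provided the radius window has the margin `(22/σ + 1)β(εθ)` (in `ε²`) on both sides, there is a TRUE MC state `s'`
(coefficient operator `W(1 + ι p)`, `‖p‖ ≤ 2β/σ`, radius `ε' = ‖v'‖`) with EXACTLY `(εθ)' = (1−β)(εθ)` ((b′)) and
`⟪c, v' − v⟫ = 0` ((46)), the drift bound (45) `|Re⟪x₀, v' − v⟫| ≤ (22/σ)β(εθ)`, and `|ε'² − ε²| ≤ (22/σ + 1)β(εθ)`.
[cite: Enflo2023, v2 (34)–(46), p.16–19] -/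
theorem exists_state_step₂ [CompleteSpace P] {ι : P →+ (E →L[ℂ] E)}
    (hιs : ∀ (t : ℝ) (p : P), ι (t • p) = (t : ℂ) • ι p) (hι1 : ∀ p, ‖ι p‖ ≤ ‖p‖)
    (hιS : ∀ p, ι p ∘L S = S ∘L ι p) (hx₀ : ‖x₀‖ = 1) (s : State T x₀ S) (he : 0 < s.etheta)
    {σ β : ℝ} (hσ : 0 < σ) (hσ1 : σ ≤ 1) (hβ0 : 0 ≤ β) (hβ : β ≤ σ ^ 2 / 1000) (c : H)
    (hind : IndepAt₂ ι σ s c) (hlo : (0.09 : ℝ) + (22 / σ + 1) * β * s.etheta ≤ s.ε ^ 2)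
    (hhi : s.ε ^ 2 + (22 / σ + 1) * β * s.etheta ≤ 0.49) :
    ∃ s' : State T x₀ S, s'.etheta = (1 - β) * s.etheta ∧ ⟪c, s'.v - s.v⟫_ℂ = 0 ∧
      |(⟪x₀, s'.v - s.v⟫_ℂ).re| ≤ 22 / σ * β * s.etheta ∧
      |s'.ε ^ 2 - s.ε ^ 2| ≤ (22 / σ + 1) * β * s.etheta ∧
      ∃ p : P, ‖p‖ ≤ 2 * β / σ ∧ s'.V = Wn s ∘L (1 + ι p) := by
  have hbr : IsBracket (Wn s) x₀ s.v := isBracket_Wn hx₀ s he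
  have hvz : s.v = bz (Wn s) x₀ := hbr.unique (isBracket_bz (Wn s) x₀)
  have hes : s.etheta = eth x₀ (bz (Wn s) x₀) := by rw [etheta_eq_eth, hvz]
  have hA : ba (Wn s) x₀ ≠ 0 := by
    intro h0
    have : eth x₀ (bz (Wn s) x₀) = 0 := by rw [eth_bz, h0, norm_zero]; ring
    linarith
  obtain ⟨p, hp, h1, h2, h3, h4⟩ := exists_step₂ (Wn s) x₀ c ι hιs hι1 hσ hσ1 hβ0 hβ hA hind
  have hbr' : IsBracket (Wn s ∘L (1 + ι p)) x₀ (zN (Wn s) x₀ (ι p)) := isBracket_zN (Wn s) x₀ (ι p)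
  have hVS' : ∀ b, (Wn s ∘L (1 + ι p)) (S b) = T ((Wn s ∘L (1 + ι p)) b) := by
    intro b
    have hNS : ι p (S b) = S (ι p b) := by
      have := congrArg (fun A : E →L[ℂ] E => A b) (hιS p)
      simpa using this
    have h1' : (1 + ι p) (S b) = S ((1 + ι p) b) := by
      simp [hNS, map_add]
    rw [comp_apply, comp_apply, h1', Wn, smul_apply, smul_apply, s.hVS, map_smul]
  have hzε : ‖bz (Wn s) x₀‖ = s.ε := by rw [← hvz]; exact s.norm_v hx₀
  rw [hzε, ← hes] at h4
  rw [← hes] at h3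
  have hwin : (0.3 : ℝ) ≤ ‖zN (Wn s) x₀ (ι p)‖ ∧ ‖zN (Wn s) x₀ (ι p)‖ ≤ 0.7 := by
    have hn := norm_nonneg (zN (Wn s) x₀ (ι p))
    have hab := abs_le.1 h4
    constructor <;> nlinarith [hab.1, hab.2, hlo, hhi, hn]
  have hmin' : IsMinimal (Wn s ∘L (1 + ι p)) x₀ ‖zN (Wn s) x₀ (ι p)‖
      (adjoint (Wn s ∘L (1 + ι p)) (zN (Wn s) x₀ (ι p))) := hbr'.isMinimal
  let s' : State T x₀ S := ⟨Wn s ∘L (1 + ι p), hVS', ‖zN (Wn s) x₀ (ι p)‖, hwin, _, hmin'⟩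
  have hv' : s'.v = zN (Wn s) x₀ (ι p) := hbr'.sub_eq
  have he' : s'.etheta = eth x₀ (zN (Wn s) x₀ (ι p)) := by rw [etheta_eq_eth, hv']
  refine ⟨s', ?_, ?_, ?_, h4, p, hp, rfl⟩
  · rw [he', hes, h1]
  · rw [hv', hvz, h2]
  · rw [hv', hvz]; exact h3


omit [NormedSpace ℝ P] in
/-- Calibration (`T = 0`, cf. `ClaimAudit.ZeroModel`): independence is SUFFICIENT, not necessary — for a RANK-ONE
normalised operator `W = ⟨·, e⟩u` every admissible first-order effect `Λ(ι p)` is a real multiple of ONE triple, so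
`IndepBr σ` fails for every `σ > 0` as soon as two of the target axes are needed; yet at `T = 0` the step exists
trivially (`ClaimRun … ⊤` holds at `T = 0`, `MCStep.claimRun_top_zero`).  Recorded here only as the statement that
independence is not universal: it fails for `W = 0` (for the three-fold form see also `not_indepBr_self`). [folklore] -/
theorem not_indepBr_zero (x₀ c : H) (ι : P →+ (E →L[ℂ] E)) (σ : ℝ) :
    ¬ IndepBr (0 : E →L[ℂ] H) x₀ c ι σ := by
  intro h
  obtain ⟨p, hp, -⟩ := h (1, 0, 0)
  have hb : ba (0 : E →L[ℂ] H) x₀ = 0 := by simp [ba]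
  have : (Λf (0 : E →L[ℂ] H) x₀ c (ι p)).1 = 0 := by simp [Λf, hb]
  rw [hp] at this
  exact one_ne_zero this

end StateLevel


end StepRealisation

end Literature.Analysis.OperatorTheory.Enflo2023

end
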